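import Literature.Probability.RandomPlanarGeometry.HexSAWSurfaceWallRenewalSlackFourThreeDownSystems
import Literature.Probability.RandomPlanarGeometry.HexSAWSurfaceWallRenewalSlackFourThreeDownFloor
import HarnessLib

/-!
# Hexagonal-lattice SAWs at a surface: slack four — classification of the three-down stratum and the exact three-down
    law

Main results (`k ≥ 2`, `m = 6k + 4`; `ipwb m` = irreducible positive wall bridges, `visits` = surface visits):
* `three_down_mem_dddBlocks_or_eq_g3b` — a block of `ipwb m` with `k` visits and exactly three down steps is one of the
  `(k−1)(2k²+3k−4)/2` table walks of `dddBlocks k` (families A2, A3, A4, A5, A6, B2,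
      B3 of `…SlackFourThreeDownFamilies`,
  step order `D D D U U U`) or the bump-then-hairpin block `g3b k` (order `D U D D U U`);
* `two_mul_card_filter_visits_three_down` — hence exactly `(k−1)(2k²+3k−4)/2 + 1` such blocks have three down steps
  (`6, 24, 61, 123, 216, 346, …` for `k = 2, 3, …`): the three-down law at slack four,
      third rung after the slack-two law
  `card_filter_visits_eq_slack_two` and the two-down laws `card_filter_visits_two_down`,
      `card_filter_visits_two_down_slack`.

Ingredients.  §1 `ddduuu4_table_a … ddduuu4_table_g` (slack-four analogues of `ddduuu_table_r/_l` of
`…SlackTwoClassification`): a walk with wall run `0 … p`, five body runs on rows `−1, −2, −3, −2, −1` with the family's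
velocities, final run back to the wall and vertical steps at the family's times agrees with the table walk up to time
`6k + 4`.  §2 `ddduuu4_eq_s3a … ddduuu4_eq_s3g`: the runs of `ddduuu4_runs` (`…SlackFourThreeDownRuns`) together with
    one
of the seven linear systems of `ddduuu4_families` (`…SlackFourThreeDownSystems`) force the five run signs,
    so the walk is
the table walk with parameters read off its step times, and lies in `dddBlocks k`.  §3 the classification (the mixed
orders are `g3b k` by `eq_g3b_of_three_down_of_up_lt_down` of `…SlackFourThreeDown`) and the law (upper bound from the
classification, lower bound `le_two_mul_card_filter_visits_three_down_succ` of `…SlackFourThreeDownFloor`).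

References: hexagonal-lattice SAW [DuminilCopinSmirnov2012]; wall-renewal (irreducible bridge) decomposition
[MadrasSlade1993, §4.2 (Definition 4.2.1, p. 90; (4.2.2)), §1.2 (Definition 1.2.4, p. 11)]; enumeration by profile
[EntingJensen2009, §7.4.2, Fig. 7.10]; surface fugacity `1 + √2` [BeatonBousquetMelouDeGierDuminilCopinGuttmann2014, §3.1].
-/

namespace Literature.Probability.RandomPlanarGeometry.SAW.HexBW.Wall

open Finset Filter Function
open Literature.Probability.LatticeModels Literature.Probability.Percolation SimpleGraph

variable {n : ℕ} {ω : ℕ → Site 2}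

/-! ### §1  The seven table walks identified from run data -/

/-- **Family A2 identified**: a walk whose initial wall run is `0 … p`, whose five body runs have the velocities of
family A2 and whose vertical steps fall at the times of the table walk `s3a k i u` coincides with it up to time
`6k + 4` (slack-four analogue of the tree's `ddduuu_table_r/_l`). [cite: MadrasSlade1993, §4.2,
    Definition 4.2.1 (p. 90)]
[cite: EntingJensen2009, §7.4.2, Fig. 7.10] -/
theorem ddduuu4_table_a {k p p₂ p₃ r₁ r₂ r₃ i u : ℕ} (hiu : i + u + 2 ≤ k)
    (hR0 : ∀ i, i ≤ p → ω i 0 = i ∧ ω i 1 = 0)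
    (hrun1 : ∀ i, p + 1 ≤ i → i ≤ p₂ → ω i 0 = p + 1 * ((i - (p + 1) : ℕ) : ℤ) ∧ ω i 1 = -1)
    (hrun2 : ∀ i, p₂ + 1 ≤ i → i ≤ p₃ → ω i 0 = ω p₂ 0 + 1 * ((i - (p₂ + 1) : ℕ) : ℤ) ∧ ω i 1 = -2)
    (hrun3 : ∀ i, p₃ + 1 ≤ i → i ≤ r₁ → ω i 0 = ω p₃ 0 + 1 * ((i - (p₃ + 1) : ℕ) : ℤ) ∧ ω i 1 = -3)
    (hrun4 : ∀ i, r₁ + 1 ≤ i → i ≤ r₂ → ω i 0 = ω r₁ 0 + (-1) * ((i - (r₁ + 1) : ℕ) : ℤ) ∧ ω i 1 = -2)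
    (hrun5 : ∀ i, r₂ + 1 ≤ i → i ≤ r₃ → ω i 0 = ω r₂ 0 + (-1) * ((i - (r₂ + 1) : ℕ) : ℤ) ∧ ω i 1 = -1)
    (hR6 : ∀ j, r₃ + 1 ≤ j → j ≤ 6 * k + 4 → ω j 0 = ω r₃ 0 + ((j - (r₃ + 1) : ℕ) : ℤ) ∧ ω j 1 = 0)
    (hpe : p = 1) (hp2e : p₂ = 3) (hp3e : p₃ = 2 * i + 5) (hr1e : r₁ = 2 * k + 4) (hr2e : r₂ = 2 * k + 2 * u
        + 6) (hr3e : r₃ = 4 * k + 4) :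
    ∀ t, t ≤ 6 * k + 4 → ω t 0 = s3aX k i u t ∧ ω t 1 = s3aY k i u t := by
  have hcb := (hrun1 p₂ (by omega) le_rfl).1
  have hcc := (hrun2 p₃ (by omega) le_rfl).1
  have hcd := (hrun3 r₁ (by omega) le_rfl).1
  have hce := (hrun4 r₂ (by omega) le_rfl).1
  have hcg := (hrun5 r₃ (by omega) le_rfl).1
  intro t ht
  simp only [s3aX, s3aY]
  rcases Nat.lt_or_ge t (p + 1) with h1 | h1
  · obtain ⟨hx, hy⟩ := hR0 t (by omega)
    have hc1 : t ≤ 1 := by omega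
    rw [hx, hy, if_pos hc1, if_pos hc1]
    constructor <;> omega
  rcases Nat.lt_or_ge t (p₂ + 1) with h2 | h2
  · obtain ⟨hx, hy⟩ := hrun1 t h1 (by omega)
    have hc1 : ¬ (t ≤ 1) := by omega
    have hc2 : t ≤ 3 := by omega
    rw [hx, hy, if_neg hc1, if_neg hc1, if_pos hc2, if_pos hc2]
    constructor <;> omega
  rcases Nat.lt_or_ge t (p₃ + 1) with h3 | h3
  · obtain ⟨hx, hy⟩ := hrun2 t h2 (by omega)
    have hc1 : ¬ (t ≤ 1) := by omega
    have hc2 : ¬ (t ≤ 3) := by omega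
    have hc3 : t ≤ 2 * i + 5 := by omega
    rw [hx, hy, if_neg hc1, if_neg hc1, if_neg hc2, if_neg hc2, if_pos hc3, if_pos hc3]
    constructor <;> omega
  rcases Nat.lt_or_ge t (r₁ + 1) with h4 | h4
  · obtain ⟨hx, hy⟩ := hrun3 t h3 (by omega)
    have hc1 : ¬ (t ≤ 1) := by omega
    have hc2 : ¬ (t ≤ 3) := by omega
    have hc3 : ¬ (t ≤ 2 * i + 5) := by omega
    have hc4 : t ≤ 2 * k + 4 := by omega
    rw [hx, hy, if_neg hc1, if_neg hc1, if_neg hc2, if_neg hc2, if_neg hc3, if_neg hc3, if_pos hc4, if_pos hc4]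
    constructor <;> omega
  rcases Nat.lt_or_ge t (r₂ + 1) with h5 | h5
  · obtain ⟨hx, hy⟩ := hrun4 t h4 (by omega)
    have hc1 : ¬ (t ≤ 1) := by omega
    have hc2 : ¬ (t ≤ 3) := by omega
    have hc3 : ¬ (t ≤ 2 * i + 5) := by omega
    have hc4 : ¬ (t ≤ 2 * k + 4) := by omega
    have hc5 : t ≤ 2 * k + 2 * u + 6 := by omega
    rw [hx, hy, if_neg hc1, if_neg hc1, if_neg hc2, if_neg hc2,
      if_neg hc3, if_neg hc3, if_neg hc4, if_neg hc4, if_pos hc5, if_pos hc5]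
    constructor <;> omega
  rcases Nat.lt_or_ge t (r₃ + 1) with h6 | h6
  · obtain ⟨hx, hy⟩ := hrun5 t h5 (by omega)
    have hc1 : ¬ (t ≤ 1) := by omega
    have hc2 : ¬ (t ≤ 3) := by omega
    have hc3 : ¬ (t ≤ 2 * i + 5) := by omega
    have hc4 : ¬ (t ≤ 2 * k + 4) := by omega
    have hc5 : ¬ (t ≤ 2 * k + 2 * u + 6) := by omega
    have hc6 : t ≤ 4 * k + 4 := by omega
    rw [hx, hy, if_neg hc1, if_neg hc1, if_neg hc2, if_neg hc2, if_neg hc3,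
      if_neg hc3, if_neg hc4, if_neg hc4, if_neg hc5, if_neg hc5, if_pos hc6, if_pos hc6]
    constructor <;> omega
  obtain ⟨hx, hy⟩ := hR6 t h6 ht
  have hc1 : ¬ (t ≤ 1) := by omega
  have hc2 : ¬ (t ≤ 3) := by omega
  have hc3 : ¬ (t ≤ 2 * i + 5) := by omega
  have hc4 : ¬ (t ≤ 2 * k + 4) := by omega
  have hc5 : ¬ (t ≤ 2 * k + 2 * u + 6) := by omega
  have hc6 : ¬ (t ≤ 4 * k + 4) := by omega
  rw [hx, hy, if_neg hc1, if_neg hc1, if_neg hc2, if_neg hc2, if_neg hc3,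
    if_neg hc3, if_neg hc4, if_neg hc4, if_neg hc5, if_neg hc5, if_neg hc6, if_neg hc6]
  constructor <;> omega

/-- **Family A3 identified**: a walk whose initial wall run is `0 … p`, whose five body runs have the velocities of
family A3 and whose vertical steps fall at the times of the table walk `s3b k a i u` coincides with it up to time
`6k + 4` (slack-four analogue of the tree's `ddduuu_table_r/_l`). [cite: MadrasSlade1993, §4.2,
    Definition 4.2.1 (p. 90)]
[cite: EntingJensen2009, §7.4.2, Fig. 7.10] -/
theorem ddduuu4_table_b {k p p₂ p₃ r₁ r₂ r₃ a i u : ℕ} (hia : i + 1 ≤ a) (hau : a + u + 2 ≤ k)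
    (hR0 : ∀ i, i ≤ p → ω i 0 = i ∧ ω i 1 = 0)
    (hrun1 : ∀ i, p + 1 ≤ i → i ≤ p₂ → ω i 0 = p + (-1) * ((i - (p + 1) : ℕ) : ℤ) ∧ ω i 1 = -1)
    (hrun2 : ∀ i, p₂ + 1 ≤ i → i ≤ p₃ → ω i 0 = ω p₂ 0 + (-1) * ((i - (p₂ + 1) : ℕ) : ℤ) ∧ ω i 1 = -2)
    (hrun3 : ∀ i, p₃ + 1 ≤ i → i ≤ r₁ → ω i 0 = ω p₃ 0 + 1 * ((i - (p₃ + 1) : ℕ) : ℤ) ∧ ω i 1 = -3)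
    (hrun4 : ∀ i, r₁ + 1 ≤ i → i ≤ r₂ → ω i 0 = ω r₁ 0 + (-1) * ((i - (r₁ + 1) : ℕ) : ℤ) ∧ ω i 1 = -2)
    (hrun5 : ∀ i, r₂ + 1 ≤ i → i ≤ r₃ → ω i 0 = ω r₂ 0 + (-1) * ((i - (r₂ + 1) : ℕ) : ℤ) ∧ ω i 1 = -1)
    (hR6 : ∀ j, r₃ + 1 ≤ j → j ≤ 6 * k + 4 → ω j 0 = ω r₃ 0 + ((j - (r₃ + 1) : ℕ) : ℤ) ∧ ω j 1 = 0)
    (hpe : p = 2 * a + 1) (hp2e : p₂ = 2 * a + 2 * i + 3) (hp3e : p₃ = 4 * a + 3) (hr1e : r₁ = 2 * k + 4 * a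
        + 4) (hr2e : r₂ = 2 * k + 4 * a + 2 * u + 6) (hr3e : r₃ = 4 * k + 2 * a + 4) :
    ∀ t, t ≤ 6 * k + 4 → ω t 0 = s3bX k a i u t ∧ ω t 1 = s3bY k a i u t := by
  have hcb := (hrun1 p₂ (by omega) le_rfl).1
  have hcc := (hrun2 p₃ (by omega) le_rfl).1
  have hcd := (hrun3 r₁ (by omega) le_rfl).1
  have hce := (hrun4 r₂ (by omega) le_rfl).1
  have hcg := (hrun5 r₃ (by omega) le_rfl).1
  intro t ht
  simp only [s3bX, s3bY]
  rcases Nat.lt_or_ge t (p + 1) with h1 | h1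
  · obtain ⟨hx, hy⟩ := hR0 t (by omega)
    have hc1 : t ≤ 2 * a + 1 := by omega
    rw [hx, hy, if_pos hc1, if_pos hc1]
    constructor <;> omega
  rcases Nat.lt_or_ge t (p₂ + 1) with h2 | h2
  · obtain ⟨hx, hy⟩ := hrun1 t h1 (by omega)
    have hc1 : ¬ (t ≤ 2 * a + 1) := by omega
    have hc2 : t ≤ 2 * a + 2 * i + 3 := by omega
    rw [hx, hy, if_neg hc1, if_neg hc1, if_pos hc2, if_pos hc2]
    constructor <;> omega
  rcases Nat.lt_or_ge t (p₃ + 1) with h3 | h3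
  · obtain ⟨hx, hy⟩ := hrun2 t h2 (by omega)
    have hc1 : ¬ (t ≤ 2 * a + 1) := by omega
    have hc2 : ¬ (t ≤ 2 * a + 2 * i + 3) := by omega
    have hc3 : t ≤ 4 * a + 3 := by omega
    rw [hx, hy, if_neg hc1, if_neg hc1, if_neg hc2, if_neg hc2, if_pos hc3, if_pos hc3]
    constructor <;> omega
  rcases Nat.lt_or_ge t (r₁ + 1) with h4 | h4
  · obtain ⟨hx, hy⟩ := hrun3 t h3 (by omega)
    have hc1 : ¬ (t ≤ 2 * a + 1) := by omega
    have hc2 : ¬ (t ≤ 2 * a + 2 * i + 3) := by omega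
    have hc3 : ¬ (t ≤ 4 * a + 3) := by omega
    have hc4 : t ≤ 2 * k + 4 * a + 4 := by omega
    rw [hx, hy, if_neg hc1, if_neg hc1, if_neg hc2, if_neg hc2, if_neg hc3, if_neg hc3, if_pos hc4, if_pos hc4]
    constructor <;> omega
  rcases Nat.lt_or_ge t (r₂ + 1) with h5 | h5
  · obtain ⟨hx, hy⟩ := hrun4 t h4 (by omega)
    have hc1 : ¬ (t ≤ 2 * a + 1) := by omega
    have hc2 : ¬ (t ≤ 2 * a + 2 * i + 3) := by omega
    have hc3 : ¬ (t ≤ 4 * a + 3) := by omega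
    have hc4 : ¬ (t ≤ 2 * k + 4 * a + 4) := by omega
    have hc5 : t ≤ 2 * k + 4 * a + 2 * u + 6 := by omega
    rw [hx, hy, if_neg hc1, if_neg hc1, if_neg hc2, if_neg hc2,
      if_neg hc3, if_neg hc3, if_neg hc4, if_neg hc4, if_pos hc5, if_pos hc5]
    constructor <;> omega
  rcases Nat.lt_or_ge t (r₃ + 1) with h6 | h6
  · obtain ⟨hx, hy⟩ := hrun5 t h5 (by omega)
    have hc1 : ¬ (t ≤ 2 * a + 1) := by omega
    have hc2 : ¬ (t ≤ 2 * a + 2 * i + 3) := by omega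
    have hc3 : ¬ (t ≤ 4 * a + 3) := by omega
    have hc4 : ¬ (t ≤ 2 * k + 4 * a + 4) := by omega
    have hc5 : ¬ (t ≤ 2 * k + 4 * a + 2 * u + 6) := by omega
    have hc6 : t ≤ 4 * k + 2 * a + 4 := by omega
    rw [hx, hy, if_neg hc1, if_neg hc1, if_neg hc2, if_neg hc2, if_neg hc3,
      if_neg hc3, if_neg hc4, if_neg hc4, if_neg hc5, if_neg hc5, if_pos hc6, if_pos hc6]
    constructor <;> omega
  obtain ⟨hx, hy⟩ := hR6 t h6 ht
  have hc1 : ¬ (t ≤ 2 * a + 1) := by omega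
  have hc2 : ¬ (t ≤ 2 * a + 2 * i + 3) := by omega
  have hc3 : ¬ (t ≤ 4 * a + 3) := by omega
  have hc4 : ¬ (t ≤ 2 * k + 4 * a + 4) := by omega
  have hc5 : ¬ (t ≤ 2 * k + 4 * a + 2 * u + 6) := by omega
  have hc6 : ¬ (t ≤ 4 * k + 2 * a + 4) := by omega
  rw [hx, hy, if_neg hc1, if_neg hc1, if_neg hc2, if_neg hc2, if_neg hc3,
    if_neg hc3, if_neg hc4, if_neg hc4, if_neg hc5, if_neg hc5, if_neg hc6, if_neg hc6]
  constructor <;> omega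

/-- **Family A4 identified**: a walk whose initial wall run is `0 … p`, whose five body runs have the velocities of
family A4 and whose vertical steps fall at the times of the table walk `s3c k i u` coincides with it up to time
`6k + 4` (slack-four analogue of the tree's `ddduuu_table_r/_l`). [cite: MadrasSlade1993, §4.2,
    Definition 4.2.1 (p. 90)]
[cite: EntingJensen2009, §7.4.2, Fig. 7.10] -/
theorem ddduuu4_table_c {k p p₂ p₃ r₁ r₂ r₃ i u : ℕ} (hui : u ≤ i) (hik : i + 2 ≤ k)
    (hR0 : ∀ i, i ≤ p → ω i 0 = i ∧ ω i 1 = 0)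
    (hrun1 : ∀ i, p + 1 ≤ i → i ≤ p₂ → ω i 0 = p + (-1) * ((i - (p + 1) : ℕ) : ℤ) ∧ ω i 1 = -1)
    (hrun2 : ∀ i, p₂ + 1 ≤ i → i ≤ p₃ → ω i 0 = ω p₂ 0 + (-1) * ((i - (p₂ + 1) : ℕ) : ℤ) ∧ ω i 1 = -2)
    (hrun3 : ∀ i, p₃ + 1 ≤ i → i ≤ r₁ → ω i 0 = ω p₃ 0 + 1 * ((i - (p₃ + 1) : ℕ) : ℤ) ∧ ω i 1 = -3)
    (hrun4 : ∀ i, r₁ + 1 ≤ i → i ≤ r₂ → ω i 0 = ω r₁ 0 + 1 * ((i - (r₁ + 1) : ℕ) : ℤ) ∧ ω i 1 = -2)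
    (hrun5 : ∀ i, r₂ + 1 ≤ i → i ≤ r₃ → ω i 0 = ω r₂ 0 + 1 * ((i - (r₂ + 1) : ℕ) : ℤ) ∧ ω i 1 = -1)
    (hR6 : ∀ j, r₃ + 1 ≤ j → j ≤ 6 * k + 4 → ω j 0 = ω r₃ 0 + ((j - (r₃ + 1) : ℕ) : ℤ) ∧ ω j 1 = 0)
    (hpe : p + 1 = 2 * k) (hp2e : p₂ = 2 * k + 2 * i + 1) (hp3e : p₃ + 1 = 4 * k) (hr1e : r₁ + 2 * u + 2
        = 6 * k) (hr2e : r₂ = 6 * k) (hr3e : r₃ = 6 * k + 2) :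
    ∀ t, t ≤ 6 * k + 4 → ω t 0 = s3cX k i u t ∧ ω t 1 = s3cY k i u t := by
  have hcb := (hrun1 p₂ (by omega) le_rfl).1
  have hcc := (hrun2 p₃ (by omega) le_rfl).1
  have hcd := (hrun3 r₁ (by omega) le_rfl).1
  have hce := (hrun4 r₂ (by omega) le_rfl).1
  have hcg := (hrun5 r₃ (by omega) le_rfl).1
  intro t ht
  simp only [s3cX, s3cY]
  rcases Nat.lt_or_ge t (p + 1) with h1 | h1
  · obtain ⟨hx, hy⟩ := hR0 t (by omega)
    have hc1 : t + 1 ≤ 2 * k := by omega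
    rw [hx, hy, if_pos hc1, if_pos hc1]
    constructor <;> omega
  rcases Nat.lt_or_ge t (p₂ + 1) with h2 | h2
  · obtain ⟨hx, hy⟩ := hrun1 t h1 (by omega)
    have hc1 : ¬ (t + 1 ≤ 2 * k) := by omega
    have hc2 : t ≤ 2 * k + 2 * i + 1 := by omega
    rw [hx, hy, if_neg hc1, if_neg hc1, if_pos hc2, if_pos hc2]
    constructor <;> omega
  rcases Nat.lt_or_ge t (p₃ + 1) with h3 | h3
  · obtain ⟨hx, hy⟩ := hrun2 t h2 (by omega)
    have hc1 : ¬ (t + 1 ≤ 2 * k) := by omega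
    have hc2 : ¬ (t ≤ 2 * k + 2 * i + 1) := by omega
    have hc3 : t + 1 ≤ 4 * k := by omega
    rw [hx, hy, if_neg hc1, if_neg hc1, if_neg hc2, if_neg hc2, if_pos hc3, if_pos hc3]
    constructor <;> omega
  rcases Nat.lt_or_ge t (r₁ + 1) with h4 | h4
  · obtain ⟨hx, hy⟩ := hrun3 t h3 (by omega)
    have hc1 : ¬ (t + 1 ≤ 2 * k) := by omega
    have hc2 : ¬ (t ≤ 2 * k + 2 * i + 1) := by omega
    have hc3 : ¬ (t + 1 ≤ 4 * k) := by omega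
    have hc4 : t + 2 * u + 2 ≤ 6 * k := by omega
    rw [hx, hy, if_neg hc1, if_neg hc1, if_neg hc2, if_neg hc2, if_neg hc3, if_neg hc3, if_pos hc4, if_pos hc4]
    constructor <;> omega
  rcases Nat.lt_or_ge t (r₂ + 1) with h5 | h5
  · obtain ⟨hx, hy⟩ := hrun4 t h4 (by omega)
    have hc1 : ¬ (t + 1 ≤ 2 * k) := by omega
    have hc2 : ¬ (t ≤ 2 * k + 2 * i + 1) := by omega
    have hc3 : ¬ (t + 1 ≤ 4 * k) := by omega
    have hc4 : ¬ (t + 2 * u + 2 ≤ 6 * k) := by omega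
    have hc5 : t ≤ 6 * k := by omega
    rw [hx, hy, if_neg hc1, if_neg hc1, if_neg hc2, if_neg hc2,
      if_neg hc3, if_neg hc3, if_neg hc4, if_neg hc4, if_pos hc5, if_pos hc5]
    constructor <;> omega
  rcases Nat.lt_or_ge t (r₃ + 1) with h6 | h6
  · obtain ⟨hx, hy⟩ := hrun5 t h5 (by omega)
    have hc1 : ¬ (t + 1 ≤ 2 * k) := by omega
    have hc2 : ¬ (t ≤ 2 * k + 2 * i + 1) := by omega
    have hc3 : ¬ (t + 1 ≤ 4 * k) := by omega
    have hc4 : ¬ (t + 2 * u + 2 ≤ 6 * k) := by omega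
    have hc5 : ¬ (t ≤ 6 * k) := by omega
    have hc6 : t ≤ 6 * k + 2 := by omega
    rw [hx, hy, if_neg hc1, if_neg hc1, if_neg hc2, if_neg hc2, if_neg hc3,
      if_neg hc3, if_neg hc4, if_neg hc4, if_neg hc5, if_neg hc5, if_pos hc6, if_pos hc6]
    constructor <;> omega
  obtain ⟨hx, hy⟩ := hR6 t h6 ht
  have hc1 : ¬ (t + 1 ≤ 2 * k) := by omega
  have hc2 : ¬ (t ≤ 2 * k + 2 * i + 1) := by omega
  have hc3 : ¬ (t + 1 ≤ 4 * k) := by omega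
  have hc4 : ¬ (t + 2 * u + 2 ≤ 6 * k) := by omega
  have hc5 : ¬ (t ≤ 6 * k) := by omega
  have hc6 : ¬ (t ≤ 6 * k + 2) := by omega
  rw [hx, hy, if_neg hc1, if_neg hc1, if_neg hc2, if_neg hc2, if_neg hc3,
    if_neg hc3, if_neg hc4, if_neg hc4, if_neg hc5, if_neg hc5, if_neg hc6, if_neg hc6]
  constructor <;> omega

/-- **Family A5 identified**: a walk whose initial wall run is `0 … p`, whose five body runs have the velocities of
family A5 and whose vertical steps fall at the times of the table walk `s3d k a i` coincides with it up to time
`6k + 4` (slack-four analogue of the tree's `ddduuu_table_r/_l`). [cite: MadrasSlade1993, §4.2,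
    Definition 4.2.1 (p. 90)]
[cite: EntingJensen2009, §7.4.2, Fig. 7.10] -/
theorem ddduuu4_table_d {k p p₂ p₃ r₁ r₂ r₃ a i : ℕ} (hia : i + 1 ≤ a) (hak : a + 1 ≤ k) (hik : i + 2 ≤ k)
    (hR0 : ∀ i, i ≤ p → ω i 0 = i ∧ ω i 1 = 0)
    (hrun1 : ∀ i, p + 1 ≤ i → i ≤ p₂ → ω i 0 = p + (-1) * ((i - (p + 1) : ℕ) : ℤ) ∧ ω i 1 = -1)
    (hrun2 : ∀ i, p₂ + 1 ≤ i → i ≤ p₃ → ω i 0 = ω p₂ 0 + 1 * ((i - (p₂ + 1) : ℕ) : ℤ) ∧ ω i 1 = -2)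
    (hrun3 : ∀ i, p₃ + 1 ≤ i → i ≤ r₁ → ω i 0 = ω p₃ 0 + 1 * ((i - (p₃ + 1) : ℕ) : ℤ) ∧ ω i 1 = -3)
    (hrun4 : ∀ i, r₁ + 1 ≤ i → i ≤ r₂ → ω i 0 = ω r₁ 0 + (-1) * ((i - (r₁ + 1) : ℕ) : ℤ) ∧ ω i 1 = -2)
    (hrun5 : ∀ i, r₂ + 1 ≤ i → i ≤ r₃ → ω i 0 = ω r₂ 0 + 1 * ((i - (r₂ + 1) : ℕ) : ℤ) ∧ ω i 1 = -1)
    (hR6 : ∀ j, r₃ + 1 ≤ j → j ≤ 6 * k + 4 → ω j 0 = ω r₃ 0 + ((j - (r₃ + 1) : ℕ) : ℤ) ∧ ω j 1 = 0)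
    (hpe : p = 2 * a + 1) (hp2e : p₂ = 4 * a + 1) (hp3e : p₃ = 4 * a + 2 * i + 3) (hr1e : r₁ = 2 * k + 4 * a
        + 2) (hr2e : r₂ = 4 * k + 2 * a + 2) (hr3e : r₃ = 4 * k + 2 * a + 4) :
    ∀ t, t ≤ 6 * k + 4 → ω t 0 = s3dX k a i t ∧ ω t 1 = s3dY k a i t := by
  have hcb := (hrun1 p₂ (by omega) le_rfl).1
  have hcc := (hrun2 p₃ (by omega) le_rfl).1
  have hcd := (hrun3 r₁ (by omega) le_rfl).1
  have hce := (hrun4 r₂ (by omega) le_rfl).1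
  have hcg := (hrun5 r₃ (by omega) le_rfl).1
  intro t ht
  simp only [s3dX, s3dY]
  rcases Nat.lt_or_ge t (p + 1) with h1 | h1
  · obtain ⟨hx, hy⟩ := hR0 t (by omega)
    have hc1 : t ≤ 2 * a + 1 := by omega
    rw [hx, hy, if_pos hc1, if_pos hc1]
    constructor <;> omega
  rcases Nat.lt_or_ge t (p₂ + 1) with h2 | h2
  · obtain ⟨hx, hy⟩ := hrun1 t h1 (by omega)
    have hc1 : ¬ (t ≤ 2 * a + 1) := by omega
    have hc2 : t ≤ 4 * a + 1 := by omega
    rw [hx, hy, if_neg hc1, if_neg hc1, if_pos hc2, if_pos hc2]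
    constructor <;> omega
  rcases Nat.lt_or_ge t (p₃ + 1) with h3 | h3
  · obtain ⟨hx, hy⟩ := hrun2 t h2 (by omega)
    have hc1 : ¬ (t ≤ 2 * a + 1) := by omega
    have hc2 : ¬ (t ≤ 4 * a + 1) := by omega
    have hc3 : t ≤ 4 * a + 2 * i + 3 := by omega
    rw [hx, hy, if_neg hc1, if_neg hc1, if_neg hc2, if_neg hc2, if_pos hc3, if_pos hc3]
    constructor <;> omega
  rcases Nat.lt_or_ge t (r₁ + 1) with h4 | h4
  · obtain ⟨hx, hy⟩ := hrun3 t h3 (by omega)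
    have hc1 : ¬ (t ≤ 2 * a + 1) := by omega
    have hc2 : ¬ (t ≤ 4 * a + 1) := by omega
    have hc3 : ¬ (t ≤ 4 * a + 2 * i + 3) := by omega
    have hc4 : t ≤ 2 * k + 4 * a + 2 := by omega
    rw [hx, hy, if_neg hc1, if_neg hc1, if_neg hc2, if_neg hc2, if_neg hc3, if_neg hc3, if_pos hc4, if_pos hc4]
    constructor <;> omega
  rcases Nat.lt_or_ge t (r₂ + 1) with h5 | h5
  · obtain ⟨hx, hy⟩ := hrun4 t h4 (by omega)
    have hc1 : ¬ (t ≤ 2 * a + 1) := by omega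
    have hc2 : ¬ (t ≤ 4 * a + 1) := by omega
    have hc3 : ¬ (t ≤ 4 * a + 2 * i + 3) := by omega
    have hc4 : ¬ (t ≤ 2 * k + 4 * a + 2) := by omega
    have hc5 : t ≤ 4 * k + 2 * a + 2 := by omega
    rw [hx, hy, if_neg hc1, if_neg hc1, if_neg hc2, if_neg hc2,
      if_neg hc3, if_neg hc3, if_neg hc4, if_neg hc4, if_pos hc5, if_pos hc5]
    constructor <;> omega
  rcases Nat.lt_or_ge t (r₃ + 1) with h6 | h6
  · obtain ⟨hx, hy⟩ := hrun5 t h5 (by omega)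
    have hc1 : ¬ (t ≤ 2 * a + 1) := by omega
    have hc2 : ¬ (t ≤ 4 * a + 1) := by omega
    have hc3 : ¬ (t ≤ 4 * a + 2 * i + 3) := by omega
    have hc4 : ¬ (t ≤ 2 * k + 4 * a + 2) := by omega
    have hc5 : ¬ (t ≤ 4 * k + 2 * a + 2) := by omega
    have hc6 : t ≤ 4 * k + 2 * a + 4 := by omega
    rw [hx, hy, if_neg hc1, if_neg hc1, if_neg hc2, if_neg hc2, if_neg hc3,
      if_neg hc3, if_neg hc4, if_neg hc4, if_neg hc5, if_neg hc5, if_pos hc6, if_pos hc6]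
    constructor <;> omega
  obtain ⟨hx, hy⟩ := hR6 t h6 ht
  have hc1 : ¬ (t ≤ 2 * a + 1) := by omega
  have hc2 : ¬ (t ≤ 4 * a + 1) := by omega
  have hc3 : ¬ (t ≤ 4 * a + 2 * i + 3) := by omega
  have hc4 : ¬ (t ≤ 2 * k + 4 * a + 2) := by omega
  have hc5 : ¬ (t ≤ 4 * k + 2 * a + 2) := by omega
  have hc6 : ¬ (t ≤ 4 * k + 2 * a + 4) := by omega
  rw [hx, hy, if_neg hc1, if_neg hc1, if_neg hc2, if_neg hc2, if_neg hc3,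
    if_neg hc3, if_neg hc4, if_neg hc4, if_neg hc5, if_neg hc5, if_neg hc6, if_neg hc6]
  constructor <;> omega

/-- **Family A6 identified**: a walk whose initial wall run is `0 … p`, whose five body runs have the velocities of
family A6 and whose vertical steps fall at the times of the table walk `s3e k a i u` coincides with it up to time
`6k + 4` (slack-four analogue of the tree's `ddduuu_table_r/_l`). [cite: MadrasSlade1993, §4.2,
    Definition 4.2.1 (p. 90)]
[cite: EntingJensen2009, §7.4.2, Fig. 7.10] -/
theorem ddduuu4_table_e {k p p₂ p₃ r₁ r₂ r₃ a i u : ℕ} (ha : 1 ≤ a) (hak : a + 1 ≤ k) (hiu : i + u + 2 ≤ k)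
    (hR0 : ∀ i, i ≤ p → ω i 0 = i ∧ ω i 1 = 0)
    (hrun1 : ∀ i, p + 1 ≤ i → i ≤ p₂ → ω i 0 = p + (-1) * ((i - (p + 1) : ℕ) : ℤ) ∧ ω i 1 = -1)
    (hrun2 : ∀ i, p₂ + 1 ≤ i → i ≤ p₃ → ω i 0 = ω p₂ 0 + 1 * ((i - (p₂ + 1) : ℕ) : ℤ) ∧ ω i 1 = -2)
    (hrun3 : ∀ i, p₃ + 1 ≤ i → i ≤ r₁ → ω i 0 = ω p₃ 0 + 1 * ((i - (p₃ + 1) : ℕ) : ℤ) ∧ ω i 1 = -3)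
    (hrun4 : ∀ i, r₁ + 1 ≤ i → i ≤ r₂ → ω i 0 = ω r₁ 0 + 1 * ((i - (r₁ + 1) : ℕ) : ℤ) ∧ ω i 1 = -2)
    (hrun5 : ∀ i, r₂ + 1 ≤ i → i ≤ r₃ → ω i 0 = ω r₂ 0 + (-1) * ((i - (r₂ + 1) : ℕ) : ℤ) ∧ ω i 1 = -1)
    (hR6 : ∀ j, r₃ + 1 ≤ j → j ≤ 6 * k + 4 → ω j 0 = ω r₃ 0 + ((j - (r₃ + 1) : ℕ) : ℤ) ∧ ω j 1 = 0)
    (hpe : p = 2 * a + 1) (hp2e : p₂ = 4 * a + 1) (hp3e : p₃ = 4 * a + 2 * i + 3) (hr1e : r₁ + 2 * u = 2 * k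
        + 4 * a + 2) (hr2e : r₂ = 2 * k + 4 * a + 4) (hr3e : r₃ = 4 * k + 2 * a + 4) :
    ∀ t, t ≤ 6 * k + 4 → ω t 0 = s3eX k a i u t ∧ ω t 1 = s3eY k a i u t := by
  have hcb := (hrun1 p₂ (by omega) le_rfl).1
  have hcc := (hrun2 p₃ (by omega) le_rfl).1
  have hcd := (hrun3 r₁ (by omega) le_rfl).1
  have hce := (hrun4 r₂ (by omega) le_rfl).1
  have hcg := (hrun5 r₃ (by omega) le_rfl).1
  intro t ht
  simp only [s3eX, s3eY]
  rcases Nat.lt_or_ge t (p + 1) with h1 | h1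
  · obtain ⟨hx, hy⟩ := hR0 t (by omega)
    have hc1 : t ≤ 2 * a + 1 := by omega
    rw [hx, hy, if_pos hc1, if_pos hc1]
    constructor <;> omega
  rcases Nat.lt_or_ge t (p₂ + 1) with h2 | h2
  · obtain ⟨hx, hy⟩ := hrun1 t h1 (by omega)
    have hc1 : ¬ (t ≤ 2 * a + 1) := by omega
    have hc2 : t ≤ 4 * a + 1 := by omega
    rw [hx, hy, if_neg hc1, if_neg hc1, if_pos hc2, if_pos hc2]
    constructor <;> omega
  rcases Nat.lt_or_ge t (p₃ + 1) with h3 | h3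
  · obtain ⟨hx, hy⟩ := hrun2 t h2 (by omega)
    have hc1 : ¬ (t ≤ 2 * a + 1) := by omega
    have hc2 : ¬ (t ≤ 4 * a + 1) := by omega
    have hc3 : t ≤ 4 * a + 2 * i + 3 := by omega
    rw [hx, hy, if_neg hc1, if_neg hc1, if_neg hc2, if_neg hc2, if_pos hc3, if_pos hc3]
    constructor <;> omega
  rcases Nat.lt_or_ge t (r₁ + 1) with h4 | h4
  · obtain ⟨hx, hy⟩ := hrun3 t h3 (by omega)
    have hc1 : ¬ (t ≤ 2 * a + 1) := by omega
    have hc2 : ¬ (t ≤ 4 * a + 1) := by omega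
    have hc3 : ¬ (t ≤ 4 * a + 2 * i + 3) := by omega
    have hc4 : t + 2 * u ≤ 2 * k + 4 * a + 2 := by omega
    rw [hx, hy, if_neg hc1, if_neg hc1, if_neg hc2, if_neg hc2, if_neg hc3, if_neg hc3, if_pos hc4, if_pos hc4]
    constructor <;> omega
  rcases Nat.lt_or_ge t (r₂ + 1) with h5 | h5
  · obtain ⟨hx, hy⟩ := hrun4 t h4 (by omega)
    have hc1 : ¬ (t ≤ 2 * a + 1) := by omega
    have hc2 : ¬ (t ≤ 4 * a + 1) := by omega
    have hc3 : ¬ (t ≤ 4 * a + 2 * i + 3) := by omega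
    have hc4 : ¬ (t + 2 * u ≤ 2 * k + 4 * a + 2) := by omega
    have hc5 : t ≤ 2 * k + 4 * a + 4 := by omega
    rw [hx, hy, if_neg hc1, if_neg hc1, if_neg hc2, if_neg hc2,
      if_neg hc3, if_neg hc3, if_neg hc4, if_neg hc4, if_pos hc5, if_pos hc5]
    constructor <;> omega
  rcases Nat.lt_or_ge t (r₃ + 1) with h6 | h6
  · obtain ⟨hx, hy⟩ := hrun5 t h5 (by omega)
    have hc1 : ¬ (t ≤ 2 * a + 1) := by omega
    have hc2 : ¬ (t ≤ 4 * a + 1) := by omega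
    have hc3 : ¬ (t ≤ 4 * a + 2 * i + 3) := by omega
    have hc4 : ¬ (t + 2 * u ≤ 2 * k + 4 * a + 2) := by omega
    have hc5 : ¬ (t ≤ 2 * k + 4 * a + 4) := by omega
    have hc6 : t ≤ 4 * k + 2 * a + 4 := by omega
    rw [hx, hy, if_neg hc1, if_neg hc1, if_neg hc2, if_neg hc2, if_neg hc3,
      if_neg hc3, if_neg hc4, if_neg hc4, if_neg hc5, if_neg hc5, if_pos hc6, if_pos hc6]
    constructor <;> omega
  obtain ⟨hx, hy⟩ := hR6 t h6 ht
  have hc1 : ¬ (t ≤ 2 * a + 1) := by omega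
  have hc2 : ¬ (t ≤ 4 * a + 1) := by omega
  have hc3 : ¬ (t ≤ 4 * a + 2 * i + 3) := by omega
  have hc4 : ¬ (t + 2 * u ≤ 2 * k + 4 * a + 2) := by omega
  have hc5 : ¬ (t ≤ 2 * k + 4 * a + 4) := by omega
  have hc6 : ¬ (t ≤ 4 * k + 2 * a + 4) := by omega
  rw [hx, hy, if_neg hc1, if_neg hc1, if_neg hc2, if_neg hc2, if_neg hc3,
    if_neg hc3, if_neg hc4, if_neg hc4, if_neg hc5, if_neg hc5, if_neg hc6, if_neg hc6]
  constructor <;> omega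

/-- **Family B2 identified**: a walk whose initial wall run is `0 … p`, whose five body runs have the velocities of
family B2 and whose vertical steps fall at the times of the table walk `s3f k a i u` coincides with it up to time
`6k + 4` (slack-four analogue of the tree's `ddduuu_table_r/_l`). [cite: MadrasSlade1993, §4.2,
    Definition 4.2.1 (p. 90)]
[cite: EntingJensen2009, §7.4.2, Fig. 7.10] -/
theorem ddduuu4_table_f {k p p₂ p₃ r₁ r₂ r₃ a i u : ℕ} (ha : 1 ≤ a) (hau : a + u + 2 ≤ k) (hiu : i + u + 1 ≤ k)
    (hR0 : ∀ i, i ≤ p → ω i 0 = i ∧ ω i 1 = 0)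
    (hrun1 : ∀ i, p + 1 ≤ i → i ≤ p₂ → ω i 0 = p + (-1) * ((i - (p + 1) : ℕ) : ℤ) ∧ ω i 1 = -1)
    (hrun2 : ∀ i, p₂ + 1 ≤ i → i ≤ p₃ → ω i 0 = ω p₂ 0 + 1 * ((i - (p₂ + 1) : ℕ) : ℤ) ∧ ω i 1 = -2)
    (hrun3 : ∀ i, p₃ + 1 ≤ i → i ≤ r₁ → ω i 0 = ω p₃ 0 + 1 * ((i - (p₃ + 1) : ℕ) : ℤ) ∧ ω i 1 = -3)
    (hrun4 : ∀ i, r₁ + 1 ≤ i → i ≤ r₂ → ω i 0 = ω r₁ 0 + (-1) * ((i - (r₁ + 1) : ℕ) : ℤ) ∧ ω i 1 = -2)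
    (hrun5 : ∀ i, r₂ + 1 ≤ i → i ≤ r₃ → ω i 0 = ω r₂ 0 + (-1) * ((i - (r₂ + 1) : ℕ) : ℤ) ∧ ω i 1 = -1)
    (hR6 : ∀ j, r₃ + 1 ≤ j → j ≤ 6 * k + 4 → ω j 0 = ω r₃ 0 + ((j - (r₃ + 1) : ℕ) : ℤ) ∧ ω j 1 = 0)
    (hpe : p = 2 * a + 1) (hp2e : p₂ = 4 * a + 1) (hp3e : p₃ = 4 * a + 2 * i + 3) (hr1e : r₁ = 2 * k + 4 * a
        + 4) (hr2e : r₂ = 2 * k + 4 * a + 2 * u + 6) (hr3e : r₃ = 4 * k + 2 * a + 4) :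
    ∀ t, t ≤ 6 * k + 4 → ω t 0 = s3fX k a i u t ∧ ω t 1 = s3fY k a i u t := by
  have hcb := (hrun1 p₂ (by omega) le_rfl).1
  have hcc := (hrun2 p₃ (by omega) le_rfl).1
  have hcd := (hrun3 r₁ (by omega) le_rfl).1
  have hce := (hrun4 r₂ (by omega) le_rfl).1
  have hcg := (hrun5 r₃ (by omega) le_rfl).1
  intro t ht
  simp only [s3fX, s3fY]
  rcases Nat.lt_or_ge t (p + 1) with h1 | h1
  · obtain ⟨hx, hy⟩ := hR0 t (by omega)
    have hc1 : t ≤ 2 * a + 1 := by omega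
    rw [hx, hy, if_pos hc1, if_pos hc1]
    constructor <;> omega
  rcases Nat.lt_or_ge t (p₂ + 1) with h2 | h2
  · obtain ⟨hx, hy⟩ := hrun1 t h1 (by omega)
    have hc1 : ¬ (t ≤ 2 * a + 1) := by omega
    have hc2 : t ≤ 4 * a + 1 := by omega
    rw [hx, hy, if_neg hc1, if_neg hc1, if_pos hc2, if_pos hc2]
    constructor <;> omega
  rcases Nat.lt_or_ge t (p₃ + 1) with h3 | h3
  · obtain ⟨hx, hy⟩ := hrun2 t h2 (by omega)
    have hc1 : ¬ (t ≤ 2 * a + 1) := by omega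
    have hc2 : ¬ (t ≤ 4 * a + 1) := by omega
    have hc3 : t ≤ 4 * a + 2 * i + 3 := by omega
    rw [hx, hy, if_neg hc1, if_neg hc1, if_neg hc2, if_neg hc2, if_pos hc3, if_pos hc3]
    constructor <;> omega
  rcases Nat.lt_or_ge t (r₁ + 1) with h4 | h4
  · obtain ⟨hx, hy⟩ := hrun3 t h3 (by omega)
    have hc1 : ¬ (t ≤ 2 * a + 1) := by omega
    have hc2 : ¬ (t ≤ 4 * a + 1) := by omega
    have hc3 : ¬ (t ≤ 4 * a + 2 * i + 3) := by omega
    have hc4 : t ≤ 2 * k + 4 * a + 4 := by omega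
    rw [hx, hy, if_neg hc1, if_neg hc1, if_neg hc2, if_neg hc2, if_neg hc3, if_neg hc3, if_pos hc4, if_pos hc4]
    constructor <;> omega
  rcases Nat.lt_or_ge t (r₂ + 1) with h5 | h5
  · obtain ⟨hx, hy⟩ := hrun4 t h4 (by omega)
    have hc1 : ¬ (t ≤ 2 * a + 1) := by omega
    have hc2 : ¬ (t ≤ 4 * a + 1) := by omega
    have hc3 : ¬ (t ≤ 4 * a + 2 * i + 3) := by omega
    have hc4 : ¬ (t ≤ 2 * k + 4 * a + 4) := by omega
    have hc5 : t ≤ 2 * k + 4 * a + 2 * u + 6 := by omega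
    rw [hx, hy, if_neg hc1, if_neg hc1, if_neg hc2, if_neg hc2,
      if_neg hc3, if_neg hc3, if_neg hc4, if_neg hc4, if_pos hc5, if_pos hc5]
    constructor <;> omega
  rcases Nat.lt_or_ge t (r₃ + 1) with h6 | h6
  · obtain ⟨hx, hy⟩ := hrun5 t h5 (by omega)
    have hc1 : ¬ (t ≤ 2 * a + 1) := by omega
    have hc2 : ¬ (t ≤ 4 * a + 1) := by omega
    have hc3 : ¬ (t ≤ 4 * a + 2 * i + 3) := by omega
    have hc4 : ¬ (t ≤ 2 * k + 4 * a + 4) := by omega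
    have hc5 : ¬ (t ≤ 2 * k + 4 * a + 2 * u + 6) := by omega
    have hc6 : t ≤ 4 * k + 2 * a + 4 := by omega
    rw [hx, hy, if_neg hc1, if_neg hc1, if_neg hc2, if_neg hc2, if_neg hc3,
      if_neg hc3, if_neg hc4, if_neg hc4, if_neg hc5, if_neg hc5, if_pos hc6, if_pos hc6]
    constructor <;> omega
  obtain ⟨hx, hy⟩ := hR6 t h6 ht
  have hc1 : ¬ (t ≤ 2 * a + 1) := by omega
  have hc2 : ¬ (t ≤ 4 * a + 1) := by omega
  have hc3 : ¬ (t ≤ 4 * a + 2 * i + 3) := by omega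
  have hc4 : ¬ (t ≤ 2 * k + 4 * a + 4) := by omega
  have hc5 : ¬ (t ≤ 2 * k + 4 * a + 2 * u + 6) := by omega
  have hc6 : ¬ (t ≤ 4 * k + 2 * a + 4) := by omega
  rw [hx, hy, if_neg hc1, if_neg hc1, if_neg hc2, if_neg hc2, if_neg hc3,
    if_neg hc3, if_neg hc4, if_neg hc4, if_neg hc5, if_neg hc5, if_neg hc6, if_neg hc6]
  constructor <;> omega

/-- **Family B3 identified**: a walk whose initial wall run is `0 … p`, whose five body runs have the velocities of
family B3 and whose vertical steps fall at the times of the table walk `s3g k i u g` coincides with it up to time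
`6k + 4` (slack-four analogue of the tree's `ddduuu_table_r/_l`). [cite: MadrasSlade1993, §4.2,
    Definition 4.2.1 (p. 90)]
[cite: EntingJensen2009, §7.4.2, Fig. 7.10] -/
theorem ddduuu4_table_g {k p p₂ p₃ r₁ r₂ r₃ i u g : ℕ} (hg : g ≤ 1) (hiug : i + u + g + 2 ≤ k)
    (hR0 : ∀ i, i ≤ p → ω i 0 = i ∧ ω i 1 = 0)
    (hrun1 : ∀ i, p + 1 ≤ i → i ≤ p₂ → ω i 0 = p + (-1) * ((i - (p + 1) : ℕ) : ℤ) ∧ ω i 1 = -1)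
    (hrun2 : ∀ i, p₂ + 1 ≤ i → i ≤ p₃ → ω i 0 = ω p₂ 0 + 1 * ((i - (p₂ + 1) : ℕ) : ℤ) ∧ ω i 1 = -2)
    (hrun3 : ∀ i, p₃ + 1 ≤ i → i ≤ r₁ → ω i 0 = ω p₃ 0 + 1 * ((i - (p₃ + 1) : ℕ) : ℤ) ∧ ω i 1 = -3)
    (hrun4 : ∀ i, r₁ + 1 ≤ i → i ≤ r₂ → ω i 0 = ω r₁ 0 + 1 * ((i - (r₁ + 1) : ℕ) : ℤ) ∧ ω i 1 = -2)
    (hrun5 : ∀ i, r₂ + 1 ≤ i → i ≤ r₃ → ω i 0 = ω r₂ 0 + 1 * ((i - (r₂ + 1) : ℕ) : ℤ) ∧ ω i 1 = -1)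
    (hR6 : ∀ j, r₃ + 1 ≤ j → j ≤ 6 * k + 4 → ω j 0 = ω r₃ 0 + ((j - (r₃ + 1) : ℕ) : ℤ) ∧ ω j 1 = 0)
    (hpe : p + 1 = 2 * k) (hp2e : p₂ + 3 = 4 * k) (hp3e : p₃ + 1 = 4 * k + 2 * i) (hr1e : r₁ + 2 * u + 2 * g + 2
        = 6 * k) (hr2e : r₂ + 2 * g = 6 * k) (hr3e : r₃ = 6 * k + 2) :
    ∀ t, t ≤ 6 * k + 4 → ω t 0 = s3gX k i u g t ∧ ω t 1 = s3gY k i u g t := by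
  have hcb := (hrun1 p₂ (by omega) le_rfl).1
  have hcc := (hrun2 p₃ (by omega) le_rfl).1
  have hcd := (hrun3 r₁ (by omega) le_rfl).1
  have hce := (hrun4 r₂ (by omega) le_rfl).1
  have hcg := (hrun5 r₃ (by omega) le_rfl).1
  intro t ht
  simp only [s3gX, s3gY]
  rcases Nat.lt_or_ge t (p + 1) with h1 | h1
  · obtain ⟨hx, hy⟩ := hR0 t (by omega)
    have hc1 : t + 1 ≤ 2 * k := by omega
    rw [hx, hy, if_pos hc1, if_pos hc1]
    constructor <;> omega
  rcases Nat.lt_or_ge t (p₂ + 1) with h2 | h2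
  · obtain ⟨hx, hy⟩ := hrun1 t h1 (by omega)
    have hc1 : ¬ (t + 1 ≤ 2 * k) := by omega
    have hc2 : t + 3 ≤ 4 * k := by omega
    rw [hx, hy, if_neg hc1, if_neg hc1, if_pos hc2, if_pos hc2]
    constructor <;> omega
  rcases Nat.lt_or_ge t (p₃ + 1) with h3 | h3
  · obtain ⟨hx, hy⟩ := hrun2 t h2 (by omega)
    have hc1 : ¬ (t + 1 ≤ 2 * k) := by omega
    have hc2 : ¬ (t + 3 ≤ 4 * k) := by omega
    have hc3 : t + 1 ≤ 4 * k + 2 * i := by omega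
    rw [hx, hy, if_neg hc1, if_neg hc1, if_neg hc2, if_neg hc2, if_pos hc3, if_pos hc3]
    constructor <;> omega
  rcases Nat.lt_or_ge t (r₁ + 1) with h4 | h4
  · obtain ⟨hx, hy⟩ := hrun3 t h3 (by omega)
    have hc1 : ¬ (t + 1 ≤ 2 * k) := by omega
    have hc2 : ¬ (t + 3 ≤ 4 * k) := by omega
    have hc3 : ¬ (t + 1 ≤ 4 * k + 2 * i) := by omega
    have hc4 : t + 2 * u + 2 * g + 2 ≤ 6 * k := by omega
    rw [hx, hy, if_neg hc1, if_neg hc1, if_neg hc2, if_neg hc2, if_neg hc3, if_neg hc3, if_pos hc4, if_pos hc4]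
    constructor <;> omega
  rcases Nat.lt_or_ge t (r₂ + 1) with h5 | h5
  · obtain ⟨hx, hy⟩ := hrun4 t h4 (by omega)
    have hc1 : ¬ (t + 1 ≤ 2 * k) := by omega
    have hc2 : ¬ (t + 3 ≤ 4 * k) := by omega
    have hc3 : ¬ (t + 1 ≤ 4 * k + 2 * i) := by omega
    have hc4 : ¬ (t + 2 * u + 2 * g + 2 ≤ 6 * k) := by omega
    have hc5 : t + 2 * g ≤ 6 * k := by omega
    rw [hx, hy, if_neg hc1, if_neg hc1, if_neg hc2, if_neg hc2,
      if_neg hc3, if_neg hc3, if_neg hc4, if_neg hc4, if_pos hc5, if_pos hc5]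
    constructor <;> omega
  rcases Nat.lt_or_ge t (r₃ + 1) with h6 | h6
  · obtain ⟨hx, hy⟩ := hrun5 t h5 (by omega)
    have hc1 : ¬ (t + 1 ≤ 2 * k) := by omega
    have hc2 : ¬ (t + 3 ≤ 4 * k) := by omega
    have hc3 : ¬ (t + 1 ≤ 4 * k + 2 * i) := by omega
    have hc4 : ¬ (t + 2 * u + 2 * g + 2 ≤ 6 * k) := by omega
    have hc5 : ¬ (t + 2 * g ≤ 6 * k) := by omega
    have hc6 : t ≤ 6 * k + 2 := by omega
    rw [hx, hy, if_neg hc1, if_neg hc1, if_neg hc2, if_neg hc2, if_neg hc3,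
      if_neg hc3, if_neg hc4, if_neg hc4, if_neg hc5, if_neg hc5, if_pos hc6, if_pos hc6]
    constructor <;> omega
  obtain ⟨hx, hy⟩ := hR6 t h6 ht
  have hc1 : ¬ (t + 1 ≤ 2 * k) := by omega
  have hc2 : ¬ (t + 3 ≤ 4 * k) := by omega
  have hc3 : ¬ (t + 1 ≤ 4 * k + 2 * i) := by omega
  have hc4 : ¬ (t + 2 * u + 2 * g + 2 ≤ 6 * k) := by omega
  have hc5 : ¬ (t + 2 * g ≤ 6 * k) := by omega
  have hc6 : ¬ (t ≤ 6 * k + 2) := by omega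
  rw [hx, hy, if_neg hc1, if_neg hc1, if_neg hc2, if_neg hc2, if_neg hc3,
    if_neg hc3, if_neg hc4, if_neg hc4, if_neg hc5, if_neg hc5, if_neg hc6, if_neg hc6]
  constructor <;> omega


/-! ### §2  From a linear system to the table walk (and into `dddBlocks`) -/

/-- Membership in the triangle (copy of the private lemma of `…ThreeDownFamilies`). [folklore] -/
private theorem mem_triIdx4 {n : ℕ} {p : ℕ × ℕ} : p ∈ triIdx n ↔ p.1 + p.2 < n := by
  simp only [triIdx, mem_filter, mem_product, mem_range]
  omega

/-- Membership in the tetrahedron (copy). [folklore] -/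
private theorem mem_tetIdx4 {n : ℕ} {p : ℕ × ℕ × ℕ} : p ∈ tetIdx n ↔ p.1 + p.2.1 + p.2.2 < n := by
  simp only [tetIdx, mem_filter, mem_product, mem_range]
  omega

/-- Membership in the double triangle (copy). [folklore] -/
private theorem mem_dtrIdx4 {n : ℕ} {p : ℕ × ℕ × ℕ} : p ∈ dtrIdx n ↔ p.1 + p.2.2 < n ∧ p.2.1 + p.2.2 < n := by
  simp only [dtrIdx, mem_filter, mem_product, mem_range]
  omega

open Classical in
/-- The A2 table walks lie in `dddBlocks`. [folklore] -/
private theorem s3a_mem_dddBlocks {k i u : ℕ} (h : i + u + 2 ≤ k) : s3a k i u ∈ dddBlocks k := by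
  have hm : s3a k i u ∈ a2Img k := Finset.mem_image.2 ⟨(i, u), mem_triIdx4.2 (by simp only; omega), rfl⟩
  simp only [dddBlocks, Finset.mem_union]
  exact Or.inl <| Or.inl <| Or.inl <| Or.inl <| Or.inl <| Or.inl <| Or.inl <| Or.inl <| Or.inl hm

open Classical in
/-- The A3 table walks lie in `dddBlocks`. [folklore] -/
private theorem s3b_mem_dddBlocks {k a i u : ℕ} (hia : i + 1 ≤ a) (hau : a + u + 2
    ≤ k) : s3b k a i u ∈ dddBlocks k := by
  have hm : s3b k a i u ∈ a3Img k := Finset.mem_image.2 ⟨(a - i - 1, i, u), mem_tetIdx4.2 (by simp only; omega),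
    by simp only [show a - i - 1 + i + 1 = a from by omega]⟩
  simp only [dddBlocks, Finset.mem_union]
  exact Or.inl <| Or.inl <| Or.inl <| Or.inl <| Or.inl <| Or.inl <| Or.inl <| Or.inl <| Or.inr hm

open Classical in
/-- The A4 table walks lie in `dddBlocks`. [folklore] -/
private theorem s3c_mem_dddBlocks {k i u : ℕ} (hui : u ≤ i) (hik : i + 2 ≤ k) : s3c k i u ∈ dddBlocks k := by
  have hm : s3c k i u ∈ a4Img k := Finset.mem_image.2 ⟨(i - u, u), mem_triIdx4.2 (by simp only; omega),
    by simp only [show i - u + u = i from by omega]⟩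
  simp only [dddBlocks, Finset.mem_union]
  exact Or.inl <| Or.inl <| Or.inl <| Or.inl <| Or.inl <| Or.inl <| Or.inl <| Or.inr hm

open Classical in
/-- The A5 table walks lie in `dddBlocks`. [folklore] -/
private theorem s3d_mem_dddBlocks {k a i : ℕ} (hia : i + 1 ≤ a) (hak : a + 1 ≤ k) (_hik : i + 2 ≤ k) :
    s3d k a i ∈ dddBlocks k := by
  have hm : s3d k a i ∈ a5Img k := Finset.mem_image.2 ⟨(a - i - 1, i), mem_triIdx4.2 (by simp only; omega),
    by simp only [show a - i - 1 + i + 1 = a from by omega]⟩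
  simp only [dddBlocks, Finset.mem_union]
  exact Or.inl <| Or.inl <| Or.inl <| Or.inl <| Or.inl <| Or.inl <| Or.inr hm

open Classical in
/-- The A6 table walks lie in `dddBlocks`. [folklore] -/
private theorem s3e_mem_dddBlocks {k a i u : ℕ} (ha : 1 ≤ a) (hak : a + 1 ≤ k) (hiu : i + u + 2 ≤ k) :
    s3e k a i u ∈ dddBlocks k := by
  have hm : s3e k a i u ∈ a6Img k := Finset.mem_image.2 ⟨(a - 1, i, u),
    Finset.mem_product.2 ⟨Finset.mem_range.2 (by simp only; omega), mem_triIdx4.2 (by simp only; omega)⟩,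
    by simp only [show a - 1 + 1 = a from by omega]⟩
  simp only [dddBlocks, Finset.mem_union]
  exact Or.inl <| Or.inl <| Or.inl <| Or.inl <| Or.inl <| Or.inr hm

open Classical in
/-- The B2 table walks lie in `dddBlocks` (three images according to `i + u` versus `k − 3, k − 2,
    k − 1`). [folklore] -/
private theorem s3f_mem_dddBlocks {k a i u : ℕ} (ha : 1 ≤ a) (hau : a + u + 2 ≤ k) (hiu : i + u + 1 ≤ k) :
    s3f k a i u ∈ dddBlocks k := by
  simp only [dddBlocks, Finset.mem_union]
  rcases Nat.lt_or_ge (i + u + 2) k with h | h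
  · have hm : s3f k a i u ∈ b2ImgLo k := Finset.mem_image.2 ⟨(a - 1, i, u), mem_dtrIdx4.2 (by simp only; omega),
      by simp only [show a - 1 + 1 = a from by omega]⟩
    exact Or.inl <| Or.inl <| Or.inl <| Or.inl <| Or.inr hm
  rcases Nat.lt_or_ge (i + u + 1) k with h' | h'
  · have hm : s3f k a i u ∈ b2ImgMid k := Finset.mem_image.2 ⟨(a - 1, u), mem_triIdx4.2 (by simp only; omega),
      by simp only [show a - 1 + 1 = a from by omega, show k - 2 - u = i from by omega]⟩
    exact Or.inl <| Or.inl <| Or.inl <| Or.inr hm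
  · have hm : s3f k a i u ∈ b2ImgHi k := Finset.mem_image.2 ⟨(a - 1, u), mem_triIdx4.2 (by simp only; omega),
      by simp only [show a - 1 + 1 = a from by omega, show k - 1 - u = i from by omega]⟩
    exact Or.inl <| Or.inl <| Or.inr hm

open Classical in
/-- The B3 table walks lie in `dddBlocks` (two images according to `g = 0, 1`). [folklore] -/
private theorem s3g_mem_dddBlocks {k i u g : ℕ} (hg : g ≤ 1) (hiug : i + u + g + 2 ≤ k) :
    s3g k i u g ∈ dddBlocks k := by
  simp only [dddBlocks, Finset.mem_union]
  rcases Nat.eq_zero_or_pos g with rfl | hg1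
  · have hm : s3g k i u 0 ∈ b3ImgLo k := Finset.mem_image.2 ⟨(i, u), mem_triIdx4.2 (by simp only; omega), rfl⟩
    exact Or.inl <| Or.inr hm
  · obtain rfl : g = 1 := by omega
    have hm : s3g k i u 1 ∈ b3ImgHi k := Finset.mem_image.2 ⟨(i, u), mem_triIdx4.2 (by simp only; omega), rfl⟩
    exact Or.inr hm

/-- **A block satisfying system A2 is the table walk `s3a`** with the parameters read off its step times
(signs of the five body runs are forced by the system; then `ddduuu4_table_a` and `eq_tab_walk_of_forall`); in
    particular it
lies in `dddBlocks k`.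
[cite: MadrasSlade1993, §4.2, Definition 4.2.1 (p. 90)] [cite: EntingJensen2009, §7.4.2, Fig. 7.10] -/
theorem ddduuu4_eq_s3a {k m p₁ p₂ p₃ r₁ r₂ r₃ c1 c2 c3 c4 c5 : ℕ} {e₁ e₂ e₃ e₄ e₅ : ℤ} (hm : m = 6 * k + 4)
    (hs : ω ∈ saws m) (hR0 : ∀ i, i ≤ p₁ → ω i 0 = i ∧ ω i 1 = 0) (he₁ : e₁ = 1 ∨ e₁ = -1) (he₂ : e₂ = 1 ∨ e₂ = -1)
    (he₃ : e₃ = 1 ∨ e₃ = -1) (he₄ : e₄ = 1 ∨ e₄ = -1) (he₅ : e₅ = 1 ∨ e₅ = -1)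
    (hrun1 : ∀ i, p₁ + 1 ≤ i → i ≤ p₂ → ω i 0 = p₁ + e₁ * ((i - (p₁ + 1) : ℕ) : ℤ) ∧ ω i 1 = -1)
    (hrun2 : ∀ i, p₂ + 1 ≤ i → i ≤ p₃ → ω i 0 = ω p₂ 0 + e₂ * ((i - (p₂ + 1) : ℕ) : ℤ) ∧ ω i 1 = -2)
    (hrun3 : ∀ i, p₃ + 1 ≤ i → i ≤ r₁ → ω i 0 = ω p₃ 0 + e₃ * ((i - (p₃ + 1) : ℕ) : ℤ) ∧ ω i 1 = -3)
    (hrun4 : ∀ i, r₁ + 1 ≤ i → i ≤ r₂ → ω i 0 = ω r₁ 0 + e₄ * ((i - (r₁ + 1) : ℕ) : ℤ) ∧ ω i 1 = -2)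
    (hrun5 : ∀ i, r₂ + 1 ≤ i → i ≤ r₃ → ω i 0 = ω r₂ 0 + e₅ * ((i - (r₂ + 1) : ℕ) : ℤ) ∧ ω i 1 = -1)
    (hR6 : ∀ j, r₃ + 1 ≤ j → j ≤ m → ω j 0 = ω r₃ 0 + ((j - (r₃ + 1) : ℕ) : ℤ) ∧ ω j 1 = 0)
    (_hq2 : p₁ + 2 ≤ p₂) (_hq3 : p₂ + 2 ≤ p₃) (_hr2 : p₃ + 2 ≤ r₁) (_hr4 : r₁ + 2 ≤ r₂) (_hr5 : r₂ + 2 ≤ r₃)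
    (_hr3m : r₃ < m) (_hC1 : (c1 : ℤ) = ω p₂ 0) (_hC2 : (c2 : ℤ) = ω p₃ 0) (_hC3 : (c3 : ℤ) = ω r₁ 0)
    (_hC4 : (c4 : ℤ) = ω r₂ 0) (_hC5 : (c5 : ℤ) = ω r₃ 0) (_hs_eq : r₃ + 2 * k + 1 = m + p₁)
    (_hN : ω m 0 + p₁ = ω r₃ 0 + 2 * k) (_hX1 : ω p₂ 0 ≤ ω m 0) (_hX2 : ω p₃ 0 ≤ ω m 0) (_hX3 : ω r₁ 0 ≤ ω m 0)
    (_hX4 : ω r₂ 0 ≤ ω m 0) (_hpodd : p₁ % 2 = 1) (_hbev : ω p₂ 0 % 2 = 0) (_hcodd : ω p₃ 0 % 2 = 1)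
    (_hdodd : ω r₁ 0 % 2 = 1) (_heev : ω r₂ 0 % 2 = 0) (_hgodd : ω r₃ 0 % 2 = 1) (_hb1 : 0 < ω p₂ 0)
    (_hc1 : 0 < ω p₃ 0) (_hd1 : 0 < ω r₁ 0) (_he1 : 0 < ω r₂ 0)
    (hF :
      p₁ = 1 ∧ c1 = 2 ∧ c2 = 2 + (p₃ - p₂ - 1) ∧ c3 = 2 * k + 1 ∧ c4 + (r₂ - r₁ - 1) = c3 ∧ c5 = 3 ∧ (p₃ - p₂ - 1) +
      (r₂ - r₁ - 1) + 2 ≤ 2 * k) :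
    ω = s3a k ((p₃ - p₂ - 2) / 2) ((r₂ - r₁ - 2) / 2) ∧ ω ∈ dddBlocks k := by
  subst hm
  have hB := (hrun1 p₂ (by omega) le_rfl).1
  have hC := (hrun2 p₃ (by omega) le_rfl).1
  have hD := (hrun3 r₁ (by omega) le_rfl).1
  have hE := (hrun4 r₂ (by omega) le_rfl).1
  have hG := (hrun5 r₃ (by omega) le_rfl).1
  -- sign-free end-column relations of all five runs (so that each sign is pinned with the others available)
  have S1 : ω p₂ 0 = p₁ + ((p₂ - (p₁ + 1) : ℕ) : ℤ) ∨ ω p₂ 0 + ((p₂ - (p₁ + 1) : ℕ) : ℤ) = p₁ := by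
    clear he₂ he₃ he₄ he₅ hrun1 hrun2 hrun3 hrun4 hrun5 hR0 hR6; rcases he₁ with h | h <;> rw [h] at hB <;> omega
  have S2 : ω p₃ 0 = ω p₂ 0 + ((p₃ - (p₂ + 1) : ℕ) : ℤ) ∨ ω p₃ 0 + ((p₃ - (p₂ + 1) : ℕ) : ℤ) = ω p₂ 0 := by
    clear he₁ he₃ he₄ he₅ hrun1 hrun2 hrun3 hrun4 hrun5 hR0 hR6; rcases he₂ with h | h <;> rw [h] at hC <;> omega
  have S3 : ω r₁ 0 = ω p₃ 0 + ((r₁ - (p₃ + 1) : ℕ) : ℤ) ∨ ω r₁ 0 + ((r₁ - (p₃ + 1) : ℕ) : ℤ) = ω p₃ 0 := by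
    clear he₁ he₂ he₄ he₅ hrun1 hrun2 hrun3 hrun4 hrun5 hR0 hR6; rcases he₃ with h | h <;> rw [h] at hD <;> omega
  have S4 : ω r₂ 0 = ω r₁ 0 + ((r₂ - (r₁ + 1) : ℕ) : ℤ) ∨ ω r₂ 0 + ((r₂ - (r₁ + 1) : ℕ) : ℤ) = ω r₁ 0 := by
    clear he₁ he₂ he₃ he₅ hrun1 hrun2 hrun3 hrun4 hrun5 hR0 hR6; rcases he₄ with h | h <;> rw [h] at hE <;> omega
  have S5 : ω r₃ 0 = ω r₂ 0 + ((r₃ - (r₂ + 1) : ℕ) : ℤ) ∨ ω r₃ 0 + ((r₃ - (r₂ + 1) : ℕ) : ℤ) = ω r₂ 0 := by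
    clear he₁ he₂ he₃ he₄ hrun1 hrun2 hrun3 hrun4 hrun5 hR0 hR6; rcases he₅ with h | h <;> rw [h] at hG <;> omega
  have E1 : e₁ = 1 := by
    clear he₂ he₃ he₄ he₅ hrun1 hrun2 hrun3 hrun4 hrun5 hR0 hR6
    rcases he₁ with h | h
    · exact h
    · exfalso; rw [h] at hB; omega
  subst E1
  have E2 : e₂ = 1 := by
    clear he₃ he₄ he₅ hrun1 hrun2 hrun3 hrun4 hrun5 hR0 hR6
    rcases he₂ with h | h
    · exact h
    · exfalso; rw [h] at hC; omega
  subst E2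
  have E3 : e₃ = 1 := by
    clear he₄ he₅ hrun1 hrun2 hrun3 hrun4 hrun5 hR0 hR6
    rcases he₃ with h | h
    · exact h
    · exfalso; rw [h] at hD; omega
  subst E3
  have E4 : e₄ = -1 := by
    clear he₅ hrun1 hrun2 hrun3 hrun4 hrun5 hR0 hR6
    rcases he₄ with h | h
    · exfalso; rw [h] at hE; omega
    · exact h
  subst E4
  have E5 : e₅ = -1 := by
    clear  hrun1 hrun2 hrun3 hrun4 hrun5 hR0 hR6
    rcases he₅ with h | h
    · exfalso; rw [h] at hG; omega
    · exact h
  subst E5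
  have heq : ω = s3a k ((p₃ - p₂ - 2) / 2) ((r₂ - r₁ - 2) / 2) :=
    eq_tab_walk_of_forall hs (ddduuu4_table_a (k := k) (p := p₁) (p₂ := p₂) (p₃ := p₃) (r₁ := r₁) (r₂ := r₂)
    (r₃ := r₃) (i := (p₃ - p₂ - 2) / 2) (u := (r₂ - r₁ - 2) / 2) (by omega) hR0 hrun1 hrun2 hrun3
    hrun4 hrun5 hR6 (by omega) (by omega) (by omega) (by omega) (by omega) (by omega))
  refine ⟨heq, ?_⟩
  rw [heq]
  exact s3a_mem_dddBlocks (by omega)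

/-- **A block satisfying system A3 is the table walk `s3b`** with the parameters read off its step times
(signs of the five body runs are forced by the system; then `ddduuu4_table_b` and `eq_tab_walk_of_forall`); in
    particular it
lies in `dddBlocks k`.
[cite: MadrasSlade1993, §4.2, Definition 4.2.1 (p. 90)] [cite: EntingJensen2009, §7.4.2, Fig. 7.10] -/
theorem ddduuu4_eq_s3b {k m p₁ p₂ p₃ r₁ r₂ r₃ c1 c2 c3 c4 c5 : ℕ} {e₁ e₂ e₃ e₄ e₅ : ℤ} (hm : m = 6 * k + 4)
    (hs : ω ∈ saws m) (hR0 : ∀ i, i ≤ p₁ → ω i 0 = i ∧ ω i 1 = 0) (he₁ : e₁ = 1 ∨ e₁ = -1) (he₂ : e₂ = 1 ∨ e₂ = -1)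
    (he₃ : e₃ = 1 ∨ e₃ = -1) (he₄ : e₄ = 1 ∨ e₄ = -1) (he₅ : e₅ = 1 ∨ e₅ = -1)
    (hrun1 : ∀ i, p₁ + 1 ≤ i → i ≤ p₂ → ω i 0 = p₁ + e₁ * ((i - (p₁ + 1) : ℕ) : ℤ) ∧ ω i 1 = -1)
    (hrun2 : ∀ i, p₂ + 1 ≤ i → i ≤ p₃ → ω i 0 = ω p₂ 0 + e₂ * ((i - (p₂ + 1) : ℕ) : ℤ) ∧ ω i 1 = -2)
    (hrun3 : ∀ i, p₃ + 1 ≤ i → i ≤ r₁ → ω i 0 = ω p₃ 0 + e₃ * ((i - (p₃ + 1) : ℕ) : ℤ) ∧ ω i 1 = -3)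
    (hrun4 : ∀ i, r₁ + 1 ≤ i → i ≤ r₂ → ω i 0 = ω r₁ 0 + e₄ * ((i - (r₁ + 1) : ℕ) : ℤ) ∧ ω i 1 = -2)
    (hrun5 : ∀ i, r₂ + 1 ≤ i → i ≤ r₃ → ω i 0 = ω r₂ 0 + e₅ * ((i - (r₂ + 1) : ℕ) : ℤ) ∧ ω i 1 = -1)
    (hR6 : ∀ j, r₃ + 1 ≤ j → j ≤ m → ω j 0 = ω r₃ 0 + ((j - (r₃ + 1) : ℕ) : ℤ) ∧ ω j 1 = 0)
    (_hq2 : p₁ + 2 ≤ p₂) (_hq3 : p₂ + 2 ≤ p₃) (_hr2 : p₃ + 2 ≤ r₁) (_hr4 : r₁ + 2 ≤ r₂) (_hr5 : r₂ + 2 ≤ r₃)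
    (_hr3m : r₃ < m) (_hC1 : (c1 : ℤ) = ω p₂ 0) (_hC2 : (c2 : ℤ) = ω p₃ 0) (_hC3 : (c3 : ℤ) = ω r₁ 0)
    (_hC4 : (c4 : ℤ) = ω r₂ 0) (_hC5 : (c5 : ℤ) = ω r₃ 0) (_hs_eq : r₃ + 2 * k + 1 = m + p₁)
    (_hN : ω m 0 + p₁ = ω r₃ 0 + 2 * k) (_hX1 : ω p₂ 0 ≤ ω m 0) (_hX2 : ω p₃ 0 ≤ ω m 0) (_hX3 : ω r₁ 0 ≤ ω m 0)
    (_hX4 : ω r₂ 0 ≤ ω m 0) (_hpodd : p₁ % 2 = 1) (_hbev : ω p₂ 0 % 2 = 0) (_hcodd : ω p₃ 0 % 2 = 1)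
    (_hdodd : ω r₁ 0 % 2 = 1) (_heev : ω r₂ 0 % 2 = 0) (_hgodd : ω r₃ 0 % 2 = 1) (_hb1 : 0 < ω p₂ 0)
    (_hc1 : 0 < ω p₃ 0) (_hd1 : 0 < ω r₁ 0) (_he1 : 0 < ω r₂ 0)
    (hF :
      c2 = 1 ∧ c1 + (p₂ - p₁ - 1) = p₁ ∧ c3 = 2 * k + 1 ∧ c4 + (r₂ - r₁ - 1) = c3 ∧ c5 = p₁ + 2 ∧ 3 ≤ p₁ ∧ 3 ≤ (m -
      r₃ - 1)) :
    ω = s3b k (p₁ / 2) ((p₂ - p₁ - 2) / 2) ((r₂ - r₁ - 2) / 2) ∧ ω ∈ dddBlocks k := by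
  subst hm
  have hB := (hrun1 p₂ (by omega) le_rfl).1
  have hC := (hrun2 p₃ (by omega) le_rfl).1
  have hD := (hrun3 r₁ (by omega) le_rfl).1
  have hE := (hrun4 r₂ (by omega) le_rfl).1
  have hG := (hrun5 r₃ (by omega) le_rfl).1
  -- sign-free end-column relations of all five runs (so that each sign is pinned with the others available)
  have S1 : ω p₂ 0 = p₁ + ((p₂ - (p₁ + 1) : ℕ) : ℤ) ∨ ω p₂ 0 + ((p₂ - (p₁ + 1) : ℕ) : ℤ) = p₁ := by
    clear he₂ he₃ he₄ he₅ hrun1 hrun2 hrun3 hrun4 hrun5 hR0 hR6; rcases he₁ with h | h <;> rw [h] at hB <;> omega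
  have S2 : ω p₃ 0 = ω p₂ 0 + ((p₃ - (p₂ + 1) : ℕ) : ℤ) ∨ ω p₃ 0 + ((p₃ - (p₂ + 1) : ℕ) : ℤ) = ω p₂ 0 := by
    clear he₁ he₃ he₄ he₅ hrun1 hrun2 hrun3 hrun4 hrun5 hR0 hR6; rcases he₂ with h | h <;> rw [h] at hC <;> omega
  have S3 : ω r₁ 0 = ω p₃ 0 + ((r₁ - (p₃ + 1) : ℕ) : ℤ) ∨ ω r₁ 0 + ((r₁ - (p₃ + 1) : ℕ) : ℤ) = ω p₃ 0 := by
    clear he₁ he₂ he₄ he₅ hrun1 hrun2 hrun3 hrun4 hrun5 hR0 hR6; rcases he₃ with h | h <;> rw [h] at hD <;> omega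
  have S4 : ω r₂ 0 = ω r₁ 0 + ((r₂ - (r₁ + 1) : ℕ) : ℤ) ∨ ω r₂ 0 + ((r₂ - (r₁ + 1) : ℕ) : ℤ) = ω r₁ 0 := by
    clear he₁ he₂ he₃ he₅ hrun1 hrun2 hrun3 hrun4 hrun5 hR0 hR6; rcases he₄ with h | h <;> rw [h] at hE <;> omega
  have S5 : ω r₃ 0 = ω r₂ 0 + ((r₃ - (r₂ + 1) : ℕ) : ℤ) ∨ ω r₃ 0 + ((r₃ - (r₂ + 1) : ℕ) : ℤ) = ω r₂ 0 := by
    clear he₁ he₂ he₃ he₄ hrun1 hrun2 hrun3 hrun4 hrun5 hR0 hR6; rcases he₅ with h | h <;> rw [h] at hG <;> omega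
  have E1 : e₁ = -1 := by
    clear he₂ he₃ he₄ he₅ hrun1 hrun2 hrun3 hrun4 hrun5 hR0 hR6
    rcases he₁ with h | h
    · exfalso; rw [h] at hB; omega
    · exact h
  subst E1
  have E2 : e₂ = -1 := by
    clear he₃ he₄ he₅ hrun1 hrun2 hrun3 hrun4 hrun5 hR0 hR6
    rcases he₂ with h | h
    · exfalso; rw [h] at hC; omega
    · exact h
  subst E2
  have E3 : e₃ = 1 := by
    clear he₄ he₅ hrun1 hrun2 hrun3 hrun4 hrun5 hR0 hR6
    rcases he₃ with h | h
    · exact h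
    · exfalso; rw [h] at hD; omega
  subst E3
  have E4 : e₄ = -1 := by
    clear he₅ hrun1 hrun2 hrun3 hrun4 hrun5 hR0 hR6
    rcases he₄ with h | h
    · exfalso; rw [h] at hE; omega
    · exact h
  subst E4
  have E5 : e₅ = -1 := by
    clear  hrun1 hrun2 hrun3 hrun4 hrun5 hR0 hR6
    rcases he₅ with h | h
    · exfalso; rw [h] at hG; omega
    · exact h
  subst E5
  have heq : ω = s3b k (p₁ / 2) ((p₂ - p₁ - 2) / 2) ((r₂ - r₁ - 2) / 2) :=
    eq_tab_walk_of_forall hs (ddduuu4_table_b (k := k) (p := p₁) (p₂ := p₂) (p₃ := p₃) (r₁ := r₁) (r₂ := r₂)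
    (r₃ := r₃) (a := p₁ / 2) (i := (p₂ - p₁ - 2) / 2) (u
        := (r₂ - r₁ - 2) / 2) (by omega) (by omega) hR0 hrun1 hrun2 hrun3
    hrun4 hrun5 hR6 (by omega) (by omega) (by omega) (by omega) (by omega) (by omega))
  refine ⟨heq, ?_⟩
  rw [heq]
  exact s3b_mem_dddBlocks (by omega) (by omega)

/-- **A block satisfying system A4 is the table walk `s3c`** with the parameters read off its step times
(signs of the five body runs are forced by the system; then `ddduuu4_table_c` and `eq_tab_walk_of_forall`); in
    particular it
lies in `dddBlocks k`.
[cite: MadrasSlade1993, §4.2, Definition 4.2.1 (p. 90)] [cite: EntingJensen2009, §7.4.2, Fig. 7.10] -/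
theorem ddduuu4_eq_s3c {k m p₁ p₂ p₃ r₁ r₂ r₃ c1 c2 c3 c4 c5 : ℕ} {e₁ e₂ e₃ e₄ e₅ : ℤ} (hm : m = 6 * k + 4)
    (hs : ω ∈ saws m) (hR0 : ∀ i, i ≤ p₁ → ω i 0 = i ∧ ω i 1 = 0) (he₁ : e₁ = 1 ∨ e₁ = -1) (he₂ : e₂ = 1 ∨ e₂ = -1)
    (he₃ : e₃ = 1 ∨ e₃ = -1) (he₄ : e₄ = 1 ∨ e₄ = -1) (he₅ : e₅ = 1 ∨ e₅ = -1)
    (hrun1 : ∀ i, p₁ + 1 ≤ i → i ≤ p₂ → ω i 0 = p₁ + e₁ * ((i - (p₁ + 1) : ℕ) : ℤ) ∧ ω i 1 = -1)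
    (hrun2 : ∀ i, p₂ + 1 ≤ i → i ≤ p₃ → ω i 0 = ω p₂ 0 + e₂ * ((i - (p₂ + 1) : ℕ) : ℤ) ∧ ω i 1 = -2)
    (hrun3 : ∀ i, p₃ + 1 ≤ i → i ≤ r₁ → ω i 0 = ω p₃ 0 + e₃ * ((i - (p₃ + 1) : ℕ) : ℤ) ∧ ω i 1 = -3)
    (hrun4 : ∀ i, r₁ + 1 ≤ i → i ≤ r₂ → ω i 0 = ω r₁ 0 + e₄ * ((i - (r₁ + 1) : ℕ) : ℤ) ∧ ω i 1 = -2)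
    (hrun5 : ∀ i, r₂ + 1 ≤ i → i ≤ r₃ → ω i 0 = ω r₂ 0 + e₅ * ((i - (r₂ + 1) : ℕ) : ℤ) ∧ ω i 1 = -1)
    (hR6 : ∀ j, r₃ + 1 ≤ j → j ≤ m → ω j 0 = ω r₃ 0 + ((j - (r₃ + 1) : ℕ) : ℤ) ∧ ω j 1 = 0)
    (_hq2 : p₁ + 2 ≤ p₂) (_hq3 : p₂ + 2 ≤ p₃) (_hr2 : p₃ + 2 ≤ r₁) (_hr4 : r₁ + 2 ≤ r₂) (_hr5 : r₂ + 2 ≤ r₃)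
    (_hr3m : r₃ < m) (_hC1 : (c1 : ℤ) = ω p₂ 0) (_hC2 : (c2 : ℤ) = ω p₃ 0) (_hC3 : (c3 : ℤ) = ω r₁ 0)
    (_hC4 : (c4 : ℤ) = ω r₂ 0) (_hC5 : (c5 : ℤ) = ω r₃ 0) (_hs_eq : r₃ + 2 * k + 1 = m + p₁)
    (_hN : ω m 0 + p₁ = ω r₃ 0 + 2 * k) (_hX1 : ω p₂ 0 ≤ ω m 0) (_hX2 : ω p₃ 0 ≤ ω m 0) (_hX3 : ω r₁ 0 ≤ ω m 0)
    (_hX4 : ω r₂ 0 ≤ ω m 0) (_hpodd : p₁ % 2 = 1) (_hbev : ω p₂ 0 % 2 = 0) (_hcodd : ω p₃ 0 % 2 = 1)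
    (_hdodd : ω r₁ 0 % 2 = 1) (_heev : ω r₂ 0 % 2 = 0) (_hgodd : ω r₃ 0 % 2 = 1) (_hb1 : 0 < ω p₂ 0)
    (_hc1 : 0 < ω p₃ 0) (_hd1 : 0 < ω r₁ 0) (_he1 : 0 < ω r₂ 0)
    (hF :
      p₁ + 1 = 2 * k ∧ c2 = 1 ∧ c1 + (p₂ - p₁ - 1) = p₁ ∧ c3 = 1 + (r₁ - p₃ - 1) ∧ c4 = 2 * k ∧ c5 = 2 * k + 1 ∧ 2 *
      k ≤ (p₂ - p₁ - 1) + (r₁ - p₃ - 1) + 1) :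
    ω = s3c k ((p₂ - p₁ - 2) / 2) ((r₂ - r₁ - 2) / 2) ∧ ω ∈ dddBlocks k := by
  subst hm
  have hB := (hrun1 p₂ (by omega) le_rfl).1
  have hC := (hrun2 p₃ (by omega) le_rfl).1
  have hD := (hrun3 r₁ (by omega) le_rfl).1
  have hE := (hrun4 r₂ (by omega) le_rfl).1
  have hG := (hrun5 r₃ (by omega) le_rfl).1
  -- sign-free end-column relations of all five runs (so that each sign is pinned with the others available)
  have S1 : ω p₂ 0 = p₁ + ((p₂ - (p₁ + 1) : ℕ) : ℤ) ∨ ω p₂ 0 + ((p₂ - (p₁ + 1) : ℕ) : ℤ) = p₁ := by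
    clear he₂ he₃ he₄ he₅ hrun1 hrun2 hrun3 hrun4 hrun5 hR0 hR6; rcases he₁ with h | h <;> rw [h] at hB <;> omega
  have S2 : ω p₃ 0 = ω p₂ 0 + ((p₃ - (p₂ + 1) : ℕ) : ℤ) ∨ ω p₃ 0 + ((p₃ - (p₂ + 1) : ℕ) : ℤ) = ω p₂ 0 := by
    clear he₁ he₃ he₄ he₅ hrun1 hrun2 hrun3 hrun4 hrun5 hR0 hR6; rcases he₂ with h | h <;> rw [h] at hC <;> omega
  have S3 : ω r₁ 0 = ω p₃ 0 + ((r₁ - (p₃ + 1) : ℕ) : ℤ) ∨ ω r₁ 0 + ((r₁ - (p₃ + 1) : ℕ) : ℤ) = ω p₃ 0 := by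
    clear he₁ he₂ he₄ he₅ hrun1 hrun2 hrun3 hrun4 hrun5 hR0 hR6; rcases he₃ with h | h <;> rw [h] at hD <;> omega
  have S4 : ω r₂ 0 = ω r₁ 0 + ((r₂ - (r₁ + 1) : ℕ) : ℤ) ∨ ω r₂ 0 + ((r₂ - (r₁ + 1) : ℕ) : ℤ) = ω r₁ 0 := by
    clear he₁ he₂ he₃ he₅ hrun1 hrun2 hrun3 hrun4 hrun5 hR0 hR6; rcases he₄ with h | h <;> rw [h] at hE <;> omega
  have S5 : ω r₃ 0 = ω r₂ 0 + ((r₃ - (r₂ + 1) : ℕ) : ℤ) ∨ ω r₃ 0 + ((r₃ - (r₂ + 1) : ℕ) : ℤ) = ω r₂ 0 := by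
    clear he₁ he₂ he₃ he₄ hrun1 hrun2 hrun3 hrun4 hrun5 hR0 hR6; rcases he₅ with h | h <;> rw [h] at hG <;> omega
  have E1 : e₁ = -1 := by
    clear he₂ he₃ he₄ he₅ hrun1 hrun2 hrun3 hrun4 hrun5 hR0 hR6
    rcases he₁ with h | h
    · exfalso; rw [h] at hB; omega
    · exact h
  subst E1
  have E2 : e₂ = -1 := by
    clear he₃ he₄ he₅ hrun1 hrun2 hrun3 hrun4 hrun5 hR0 hR6
    rcases he₂ with h | h
    · exfalso; rw [h] at hC; omega
    · exact h
  subst E2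
  have E3 : e₃ = 1 := by
    clear he₄ he₅ hrun1 hrun2 hrun3 hrun4 hrun5 hR0 hR6
    rcases he₃ with h | h
    · exact h
    · exfalso; rw [h] at hD; omega
  subst E3
  have E4 : e₄ = 1 := by
    clear he₅ hrun1 hrun2 hrun3 hrun4 hrun5 hR0 hR6
    rcases he₄ with h | h
    · exact h
    · exfalso; rw [h] at hE; omega
  subst E4
  have E5 : e₅ = 1 := by
    clear  hrun1 hrun2 hrun3 hrun4 hrun5 hR0 hR6
    rcases he₅ with h | h
    · exact h
    · exfalso; rw [h] at hG; omega
  subst E5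
  have heq : ω = s3c k ((p₂ - p₁ - 2) / 2) ((r₂ - r₁ - 2) / 2) :=
    eq_tab_walk_of_forall hs (ddduuu4_table_c (k := k) (p := p₁) (p₂ := p₂) (p₃ := p₃) (r₁ := r₁) (r₂ := r₂)
    (r₃ := r₃) (i := (p₂ - p₁ - 2) / 2) (u := (r₂ - r₁ - 2) / 2) (by omega) (by omega) hR0 hrun1 hrun2 hrun3
    hrun4 hrun5 hR6 (by omega) (by omega) (by omega) (by omega) (by omega) (by omega))
  refine ⟨heq, ?_⟩
  rw [heq]
  exact s3c_mem_dddBlocks (by omega) (by omega)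

/-- **A block satisfying system A5 is the table walk `s3d`** with the parameters read off its step times
(signs of the five body runs are forced by the system; then `ddduuu4_table_d` and `eq_tab_walk_of_forall`); in
    particular it
lies in `dddBlocks k`.
[cite: MadrasSlade1993, §4.2, Definition 4.2.1 (p. 90)] [cite: EntingJensen2009, §7.4.2, Fig. 7.10] -/
theorem ddduuu4_eq_s3d {k m p₁ p₂ p₃ r₁ r₂ r₃ c1 c2 c3 c4 c5 : ℕ} {e₁ e₂ e₃ e₄ e₅ : ℤ} (hm : m = 6 * k + 4)
    (hs : ω ∈ saws m) (hR0 : ∀ i, i ≤ p₁ → ω i 0 = i ∧ ω i 1 = 0) (he₁ : e₁ = 1 ∨ e₁ = -1) (he₂ : e₂ = 1 ∨ e₂ = -1)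
    (he₃ : e₃ = 1 ∨ e₃ = -1) (he₄ : e₄ = 1 ∨ e₄ = -1) (he₅ : e₅ = 1 ∨ e₅ = -1)
    (hrun1 : ∀ i, p₁ + 1 ≤ i → i ≤ p₂ → ω i 0 = p₁ + e₁ * ((i - (p₁ + 1) : ℕ) : ℤ) ∧ ω i 1 = -1)
    (hrun2 : ∀ i, p₂ + 1 ≤ i → i ≤ p₃ → ω i 0 = ω p₂ 0 + e₂ * ((i - (p₂ + 1) : ℕ) : ℤ) ∧ ω i 1 = -2)
    (hrun3 : ∀ i, p₃ + 1 ≤ i → i ≤ r₁ → ω i 0 = ω p₃ 0 + e₃ * ((i - (p₃ + 1) : ℕ) : ℤ) ∧ ω i 1 = -3)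
    (hrun4 : ∀ i, r₁ + 1 ≤ i → i ≤ r₂ → ω i 0 = ω r₁ 0 + e₄ * ((i - (r₁ + 1) : ℕ) : ℤ) ∧ ω i 1 = -2)
    (hrun5 : ∀ i, r₂ + 1 ≤ i → i ≤ r₃ → ω i 0 = ω r₂ 0 + e₅ * ((i - (r₂ + 1) : ℕ) : ℤ) ∧ ω i 1 = -1)
    (hR6 : ∀ j, r₃ + 1 ≤ j → j ≤ m → ω j 0 = ω r₃ 0 + ((j - (r₃ + 1) : ℕ) : ℤ) ∧ ω j 1 = 0)
    (_hq2 : p₁ + 2 ≤ p₂) (_hq3 : p₂ + 2 ≤ p₃) (_hr2 : p₃ + 2 ≤ r₁) (_hr4 : r₁ + 2 ≤ r₂) (_hr5 : r₂ + 2 ≤ r₃)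
    (_hr3m : r₃ < m) (_hC1 : (c1 : ℤ) = ω p₂ 0) (_hC2 : (c2 : ℤ) = ω p₃ 0) (_hC3 : (c3 : ℤ) = ω r₁ 0)
    (_hC4 : (c4 : ℤ) = ω r₂ 0) (_hC5 : (c5 : ℤ) = ω r₃ 0) (_hs_eq : r₃ + 2 * k + 1 = m + p₁)
    (_hN : ω m 0 + p₁ = ω r₃ 0 + 2 * k) (_hX1 : ω p₂ 0 ≤ ω m 0) (_hX2 : ω p₃ 0 ≤ ω m 0) (_hX3 : ω r₁ 0 ≤ ω m 0)
    (_hX4 : ω r₂ 0 ≤ ω m 0) (_hpodd : p₁ % 2 = 1) (_hbev : ω p₂ 0 % 2 = 0) (_hcodd : ω p₃ 0 % 2 = 1)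
    (_hdodd : ω r₁ 0 % 2 = 1) (_heev : ω r₂ 0 % 2 = 0) (_hgodd : ω r₃ 0 % 2 = 1) (_hb1 : 0 < ω p₂ 0)
    (_hc1 : 0 < ω p₃ 0) (_hd1 : 0 < ω r₁ 0) (_he1 : 0 < ω r₂ 0)
    (hF :
      c1 = 2 ∧ c2 = 2 + (p₃ - p₂ - 1) ∧ c3 = 2 * k + 1 ∧ c4 = p₁ + 1 ∧ c5 = p₁ + 2 ∧ (p₃ - p₂ - 1) + 2 ≤ p₁) :
    ω = s3d k (p₁ / 2) ((p₃ - p₂ - 2) / 2) ∧ ω ∈ dddBlocks k := by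
  subst hm
  have hB := (hrun1 p₂ (by omega) le_rfl).1
  have hC := (hrun2 p₃ (by omega) le_rfl).1
  have hD := (hrun3 r₁ (by omega) le_rfl).1
  have hE := (hrun4 r₂ (by omega) le_rfl).1
  have hG := (hrun5 r₃ (by omega) le_rfl).1
  -- sign-free end-column relations of all five runs (so that each sign is pinned with the others available)
  have S1 : ω p₂ 0 = p₁ + ((p₂ - (p₁ + 1) : ℕ) : ℤ) ∨ ω p₂ 0 + ((p₂ - (p₁ + 1) : ℕ) : ℤ) = p₁ := by
    clear he₂ he₃ he₄ he₅ hrun1 hrun2 hrun3 hrun4 hrun5 hR0 hR6; rcases he₁ with h | h <;> rw [h] at hB <;> omega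
  have S2 : ω p₃ 0 = ω p₂ 0 + ((p₃ - (p₂ + 1) : ℕ) : ℤ) ∨ ω p₃ 0 + ((p₃ - (p₂ + 1) : ℕ) : ℤ) = ω p₂ 0 := by
    clear he₁ he₃ he₄ he₅ hrun1 hrun2 hrun3 hrun4 hrun5 hR0 hR6; rcases he₂ with h | h <;> rw [h] at hC <;> omega
  have S3 : ω r₁ 0 = ω p₃ 0 + ((r₁ - (p₃ + 1) : ℕ) : ℤ) ∨ ω r₁ 0 + ((r₁ - (p₃ + 1) : ℕ) : ℤ) = ω p₃ 0 := by
    clear he₁ he₂ he₄ he₅ hrun1 hrun2 hrun3 hrun4 hrun5 hR0 hR6; rcases he₃ with h | h <;> rw [h] at hD <;> omega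
  have S4 : ω r₂ 0 = ω r₁ 0 + ((r₂ - (r₁ + 1) : ℕ) : ℤ) ∨ ω r₂ 0 + ((r₂ - (r₁ + 1) : ℕ) : ℤ) = ω r₁ 0 := by
    clear he₁ he₂ he₃ he₅ hrun1 hrun2 hrun3 hrun4 hrun5 hR0 hR6; rcases he₄ with h | h <;> rw [h] at hE <;> omega
  have S5 : ω r₃ 0 = ω r₂ 0 + ((r₃ - (r₂ + 1) : ℕ) : ℤ) ∨ ω r₃ 0 + ((r₃ - (r₂ + 1) : ℕ) : ℤ) = ω r₂ 0 := by
    clear he₁ he₂ he₃ he₄ hrun1 hrun2 hrun3 hrun4 hrun5 hR0 hR6; rcases he₅ with h | h <;> rw [h] at hG <;> omega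
  have E1 : e₁ = -1 := by
    clear he₂ he₃ he₄ he₅ hrun1 hrun2 hrun3 hrun4 hrun5 hR0 hR6
    rcases he₁ with h | h
    · exfalso; rw [h] at hB; omega
    · exact h
  subst E1
  have E2 : e₂ = 1 := by
    clear he₃ he₄ he₅ hrun1 hrun2 hrun3 hrun4 hrun5 hR0 hR6
    rcases he₂ with h | h
    · exact h
    · exfalso; rw [h] at hC; omega
  subst E2
  have E3 : e₃ = 1 := by
    clear he₄ he₅ hrun1 hrun2 hrun3 hrun4 hrun5 hR0 hR6
    rcases he₃ with h | h
    · exact h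
    · exfalso; rw [h] at hD; omega
  subst E3
  have E4 : e₄ = -1 := by
    clear he₅ hrun1 hrun2 hrun3 hrun4 hrun5 hR0 hR6
    rcases he₄ with h | h
    · exfalso; rw [h] at hE; omega
    · exact h
  subst E4
  have E5 : e₅ = 1 := by
    clear  hrun1 hrun2 hrun3 hrun4 hrun5 hR0 hR6
    rcases he₅ with h | h
    · exact h
    · exfalso; rw [h] at hG; omega
  subst E5
  have heq : ω = s3d k (p₁ / 2) ((p₃ - p₂ - 2) / 2) :=
    eq_tab_walk_of_forall hs (ddduuu4_table_d (k := k) (p := p₁) (p₂ := p₂) (p₃ := p₃) (r₁ := r₁) (r₂ := r₂)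
    (r₃ := r₃) (a := p₁ / 2) (i := (p₃ - p₂ - 2) / 2) (by omega) (by omega) (by omega) hR0 hrun1 hrun2 hrun3
    hrun4 hrun5 hR6 (by omega) (by omega) (by omega) (by omega) (by omega) (by omega))
  refine ⟨heq, ?_⟩
  rw [heq]
  exact s3d_mem_dddBlocks (by omega) (by omega) (by omega)

/-- **A block satisfying system A6 is the table walk `s3e`** with the parameters read off its step times
(signs of the five body runs are forced by the system; then `ddduuu4_table_e` and `eq_tab_walk_of_forall`); in
    particular it
lies in `dddBlocks k`.
[cite: MadrasSlade1993, §4.2, Definition 4.2.1 (p. 90)] [cite: EntingJensen2009, §7.4.2, Fig. 7.10] -/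
theorem ddduuu4_eq_s3e {k m p₁ p₂ p₃ r₁ r₂ r₃ c1 c2 c3 c4 c5 : ℕ} {e₁ e₂ e₃ e₄ e₅ : ℤ} (hm : m = 6 * k + 4)
    (hs : ω ∈ saws m) (hR0 : ∀ i, i ≤ p₁ → ω i 0 = i ∧ ω i 1 = 0) (he₁ : e₁ = 1 ∨ e₁ = -1) (he₂ : e₂ = 1 ∨ e₂ = -1)
    (he₃ : e₃ = 1 ∨ e₃ = -1) (he₄ : e₄ = 1 ∨ e₄ = -1) (he₅ : e₅ = 1 ∨ e₅ = -1)
    (hrun1 : ∀ i, p₁ + 1 ≤ i → i ≤ p₂ → ω i 0 = p₁ + e₁ * ((i - (p₁ + 1) : ℕ) : ℤ) ∧ ω i 1 = -1)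
    (hrun2 : ∀ i, p₂ + 1 ≤ i → i ≤ p₃ → ω i 0 = ω p₂ 0 + e₂ * ((i - (p₂ + 1) : ℕ) : ℤ) ∧ ω i 1 = -2)
    (hrun3 : ∀ i, p₃ + 1 ≤ i → i ≤ r₁ → ω i 0 = ω p₃ 0 + e₃ * ((i - (p₃ + 1) : ℕ) : ℤ) ∧ ω i 1 = -3)
    (hrun4 : ∀ i, r₁ + 1 ≤ i → i ≤ r₂ → ω i 0 = ω r₁ 0 + e₄ * ((i - (r₁ + 1) : ℕ) : ℤ) ∧ ω i 1 = -2)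
    (hrun5 : ∀ i, r₂ + 1 ≤ i → i ≤ r₃ → ω i 0 = ω r₂ 0 + e₅ * ((i - (r₂ + 1) : ℕ) : ℤ) ∧ ω i 1 = -1)
    (hR6 : ∀ j, r₃ + 1 ≤ j → j ≤ m → ω j 0 = ω r₃ 0 + ((j - (r₃ + 1) : ℕ) : ℤ) ∧ ω j 1 = 0)
    (_hq2 : p₁ + 2 ≤ p₂) (_hq3 : p₂ + 2 ≤ p₃) (_hr2 : p₃ + 2 ≤ r₁) (_hr4 : r₁ + 2 ≤ r₂) (_hr5 : r₂ + 2 ≤ r₃)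
    (_hr3m : r₃ < m) (_hC1 : (c1 : ℤ) = ω p₂ 0) (_hC2 : (c2 : ℤ) = ω p₃ 0) (_hC3 : (c3 : ℤ) = ω r₁ 0)
    (_hC4 : (c4 : ℤ) = ω r₂ 0) (_hC5 : (c5 : ℤ) = ω r₃ 0) (_hs_eq : r₃ + 2 * k + 1 = m + p₁)
    (_hN : ω m 0 + p₁ = ω r₃ 0 + 2 * k) (_hX1 : ω p₂ 0 ≤ ω m 0) (_hX2 : ω p₃ 0 ≤ ω m 0) (_hX3 : ω r₁ 0 ≤ ω m 0)
    (_hX4 : ω r₂ 0 ≤ ω m 0) (_hpodd : p₁ % 2 = 1) (_hbev : ω p₂ 0 % 2 = 0) (_hcodd : ω p₃ 0 % 2 = 1)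
    (_hdodd : ω r₁ 0 % 2 = 1) (_heev : ω r₂ 0 % 2 = 0) (_hgodd : ω r₃ 0 % 2 = 1) (_hb1 : 0 < ω p₂ 0)
    (_hc1 : 0 < ω p₃ 0) (_hd1 : 0 < ω r₁ 0) (_he1 : 0 < ω r₂ 0)
    (hF :
      c1 = 2 ∧ c2 = 2 + (p₃ - p₂ - 1) ∧ c3 = c2 + (r₁ - p₃ - 1) ∧ c4 = 2 * k + 2 ∧ c5 = p₁ + 2 ∧ 3 ≤ p₁) :
    ω = s3e k (p₁ / 2) ((p₃ - p₂ - 2) / 2) ((r₂ - r₁ - 2) / 2) ∧ ω ∈ dddBlocks k := by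
  subst hm
  have hB := (hrun1 p₂ (by omega) le_rfl).1
  have hC := (hrun2 p₃ (by omega) le_rfl).1
  have hD := (hrun3 r₁ (by omega) le_rfl).1
  have hE := (hrun4 r₂ (by omega) le_rfl).1
  have hG := (hrun5 r₃ (by omega) le_rfl).1
  -- sign-free end-column relations of all five runs (so that each sign is pinned with the others available)
  have S1 : ω p₂ 0 = p₁ + ((p₂ - (p₁ + 1) : ℕ) : ℤ) ∨ ω p₂ 0 + ((p₂ - (p₁ + 1) : ℕ) : ℤ) = p₁ := by
    clear he₂ he₃ he₄ he₅ hrun1 hrun2 hrun3 hrun4 hrun5 hR0 hR6; rcases he₁ with h | h <;> rw [h] at hB <;> omega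
  have S2 : ω p₃ 0 = ω p₂ 0 + ((p₃ - (p₂ + 1) : ℕ) : ℤ) ∨ ω p₃ 0 + ((p₃ - (p₂ + 1) : ℕ) : ℤ) = ω p₂ 0 := by
    clear he₁ he₃ he₄ he₅ hrun1 hrun2 hrun3 hrun4 hrun5 hR0 hR6; rcases he₂ with h | h <;> rw [h] at hC <;> omega
  have S3 : ω r₁ 0 = ω p₃ 0 + ((r₁ - (p₃ + 1) : ℕ) : ℤ) ∨ ω r₁ 0 + ((r₁ - (p₃ + 1) : ℕ) : ℤ) = ω p₃ 0 := by
    clear he₁ he₂ he₄ he₅ hrun1 hrun2 hrun3 hrun4 hrun5 hR0 hR6; rcases he₃ with h | h <;> rw [h] at hD <;> omega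
  have S4 : ω r₂ 0 = ω r₁ 0 + ((r₂ - (r₁ + 1) : ℕ) : ℤ) ∨ ω r₂ 0 + ((r₂ - (r₁ + 1) : ℕ) : ℤ) = ω r₁ 0 := by
    clear he₁ he₂ he₃ he₅ hrun1 hrun2 hrun3 hrun4 hrun5 hR0 hR6; rcases he₄ with h | h <;> rw [h] at hE <;> omega
  have S5 : ω r₃ 0 = ω r₂ 0 + ((r₃ - (r₂ + 1) : ℕ) : ℤ) ∨ ω r₃ 0 + ((r₃ - (r₂ + 1) : ℕ) : ℤ) = ω r₂ 0 := by
    clear he₁ he₂ he₃ he₄ hrun1 hrun2 hrun3 hrun4 hrun5 hR0 hR6; rcases he₅ with h | h <;> rw [h] at hG <;> omega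
  have E1 : e₁ = -1 := by
    clear he₂ he₃ he₄ he₅ hrun1 hrun2 hrun3 hrun4 hrun5 hR0 hR6
    rcases he₁ with h | h
    · exfalso; rw [h] at hB; omega
    · exact h
  subst E1
  have E2 : e₂ = 1 := by
    clear he₃ he₄ he₅ hrun1 hrun2 hrun3 hrun4 hrun5 hR0 hR6
    rcases he₂ with h | h
    · exact h
    · exfalso; rw [h] at hC; omega
  subst E2
  have E3 : e₃ = 1 := by
    clear he₄ he₅ hrun1 hrun2 hrun3 hrun4 hrun5 hR0 hR6
    rcases he₃ with h | h
    · exact h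
    · exfalso; rw [h] at hD; omega
  subst E3
  have E4 : e₄ = 1 := by
    clear he₅ hrun1 hrun2 hrun3 hrun4 hrun5 hR0 hR6
    rcases he₄ with h | h
    · exact h
    · exfalso; rw [h] at hE; omega
  subst E4
  have E5 : e₅ = -1 := by
    clear  hrun1 hrun2 hrun3 hrun4 hrun5 hR0 hR6
    rcases he₅ with h | h
    · exfalso; rw [h] at hG; omega
    · exact h
  subst E5
  have heq : ω = s3e k (p₁ / 2) ((p₃ - p₂ - 2) / 2) ((r₂ - r₁ - 2) / 2) :=
    eq_tab_walk_of_forall hs (ddduuu4_table_e (k := k) (p := p₁) (p₂ := p₂) (p₃ := p₃) (r₁ := r₁) (r₂ := r₂)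
    (r₃ := r₃) (a := p₁ / 2) (i := (p₃ - p₂ - 2) / 2) (u
        := (r₂ - r₁ - 2) / 2) (by omega) (by omega) (by omega) hR0 hrun1 hrun2 hrun3
    hrun4 hrun5 hR6 (by omega) (by omega) (by omega) (by omega) (by omega) (by omega))
  refine ⟨heq, ?_⟩
  rw [heq]
  exact s3e_mem_dddBlocks (by omega) (by omega) (by omega)

/-- **A block satisfying system B2 is the table walk `s3f`** with the parameters read off its step times
(signs of the five body runs are forced by the system; then `ddduuu4_table_f` and `eq_tab_walk_of_forall`); in
    particular it
lies in `dddBlocks k`.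
[cite: MadrasSlade1993, §4.2, Definition 4.2.1 (p. 90)] [cite: EntingJensen2009, §7.4.2, Fig. 7.10] -/
theorem ddduuu4_eq_s3f {k m p₁ p₂ p₃ r₁ r₂ r₃ c1 c2 c3 c4 c5 : ℕ} {e₁ e₂ e₃ e₄ e₅ : ℤ} (hm : m = 6 * k + 4)
    (hs : ω ∈ saws m) (hR0 : ∀ i, i ≤ p₁ → ω i 0 = i ∧ ω i 1 = 0) (he₁ : e₁ = 1 ∨ e₁ = -1) (he₂ : e₂ = 1 ∨ e₂ = -1)
    (he₃ : e₃ = 1 ∨ e₃ = -1) (he₄ : e₄ = 1 ∨ e₄ = -1) (he₅ : e₅ = 1 ∨ e₅ = -1)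
    (hrun1 : ∀ i, p₁ + 1 ≤ i → i ≤ p₂ → ω i 0 = p₁ + e₁ * ((i - (p₁ + 1) : ℕ) : ℤ) ∧ ω i 1 = -1)
    (hrun2 : ∀ i, p₂ + 1 ≤ i → i ≤ p₃ → ω i 0 = ω p₂ 0 + e₂ * ((i - (p₂ + 1) : ℕ) : ℤ) ∧ ω i 1 = -2)
    (hrun3 : ∀ i, p₃ + 1 ≤ i → i ≤ r₁ → ω i 0 = ω p₃ 0 + e₃ * ((i - (p₃ + 1) : ℕ) : ℤ) ∧ ω i 1 = -3)
    (hrun4 : ∀ i, r₁ + 1 ≤ i → i ≤ r₂ → ω i 0 = ω r₁ 0 + e₄ * ((i - (r₁ + 1) : ℕ) : ℤ) ∧ ω i 1 = -2)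
    (hrun5 : ∀ i, r₂ + 1 ≤ i → i ≤ r₃ → ω i 0 = ω r₂ 0 + e₅ * ((i - (r₂ + 1) : ℕ) : ℤ) ∧ ω i 1 = -1)
    (hR6 : ∀ j, r₃ + 1 ≤ j → j ≤ m → ω j 0 = ω r₃ 0 + ((j - (r₃ + 1) : ℕ) : ℤ) ∧ ω j 1 = 0)
    (_hq2 : p₁ + 2 ≤ p₂) (_hq3 : p₂ + 2 ≤ p₃) (_hr2 : p₃ + 2 ≤ r₁) (_hr4 : r₁ + 2 ≤ r₂) (_hr5 : r₂ + 2 ≤ r₃)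
    (_hr3m : r₃ < m) (_hC1 : (c1 : ℤ) = ω p₂ 0) (_hC2 : (c2 : ℤ) = ω p₃ 0) (_hC3 : (c3 : ℤ) = ω r₁ 0)
    (_hC4 : (c4 : ℤ) = ω r₂ 0) (_hC5 : (c5 : ℤ) = ω r₃ 0) (_hs_eq : r₃ + 2 * k + 1 = m + p₁)
    (_hN : ω m 0 + p₁ = ω r₃ 0 + 2 * k) (_hX1 : ω p₂ 0 ≤ ω m 0) (_hX2 : ω p₃ 0 ≤ ω m 0) (_hX3 : ω r₁ 0 ≤ ω m 0)
    (_hX4 : ω r₂ 0 ≤ ω m 0) (_hpodd : p₁ % 2 = 1) (_hbev : ω p₂ 0 % 2 = 0) (_hcodd : ω p₃ 0 % 2 = 1)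
    (_hdodd : ω r₁ 0 % 2 = 1) (_heev : ω r₂ 0 % 2 = 0) (_hgodd : ω r₃ 0 % 2 = 1) (_hb1 : 0 < ω p₂ 0)
    (_hc1 : 0 < ω p₃ 0) (_hd1 : 0 < ω r₁ 0) (_he1 : 0 < ω r₂ 0)
    (hF :
      c1 = 2 ∧ c2 = 2 + (p₃ - p₂ - 1) ∧ c3 = 2 * k + 3 ∧ c4 + (r₂ - r₁ - 1) = c3 ∧ c5 = p₁ + 4 ∧ (p₃ - p₂ - 1) + (r₂
      - r₁ - 1) ≤ 2 * k ∧ 3 ≤ (m - r₃ - 1)) :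
    ω = s3f k (p₁ / 2) ((p₃ - p₂ - 2) / 2) ((r₂ - r₁ - 2) / 2) ∧ ω ∈ dddBlocks k := by
  subst hm
  have hB := (hrun1 p₂ (by omega) le_rfl).1
  have hC := (hrun2 p₃ (by omega) le_rfl).1
  have hD := (hrun3 r₁ (by omega) le_rfl).1
  have hE := (hrun4 r₂ (by omega) le_rfl).1
  have hG := (hrun5 r₃ (by omega) le_rfl).1
  -- sign-free end-column relations of all five runs (so that each sign is pinned with the others available)
  have S1 : ω p₂ 0 = p₁ + ((p₂ - (p₁ + 1) : ℕ) : ℤ) ∨ ω p₂ 0 + ((p₂ - (p₁ + 1) : ℕ) : ℤ) = p₁ := by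
    clear he₂ he₃ he₄ he₅ hrun1 hrun2 hrun3 hrun4 hrun5 hR0 hR6; rcases he₁ with h | h <;> rw [h] at hB <;> omega
  have S2 : ω p₃ 0 = ω p₂ 0 + ((p₃ - (p₂ + 1) : ℕ) : ℤ) ∨ ω p₃ 0 + ((p₃ - (p₂ + 1) : ℕ) : ℤ) = ω p₂ 0 := by
    clear he₁ he₃ he₄ he₅ hrun1 hrun2 hrun3 hrun4 hrun5 hR0 hR6; rcases he₂ with h | h <;> rw [h] at hC <;> omega
  have S3 : ω r₁ 0 = ω p₃ 0 + ((r₁ - (p₃ + 1) : ℕ) : ℤ) ∨ ω r₁ 0 + ((r₁ - (p₃ + 1) : ℕ) : ℤ) = ω p₃ 0 := by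
    clear he₁ he₂ he₄ he₅ hrun1 hrun2 hrun3 hrun4 hrun5 hR0 hR6; rcases he₃ with h | h <;> rw [h] at hD <;> omega
  have S4 : ω r₂ 0 = ω r₁ 0 + ((r₂ - (r₁ + 1) : ℕ) : ℤ) ∨ ω r₂ 0 + ((r₂ - (r₁ + 1) : ℕ) : ℤ) = ω r₁ 0 := by
    clear he₁ he₂ he₃ he₅ hrun1 hrun2 hrun3 hrun4 hrun5 hR0 hR6; rcases he₄ with h | h <;> rw [h] at hE <;> omega
  have S5 : ω r₃ 0 = ω r₂ 0 + ((r₃ - (r₂ + 1) : ℕ) : ℤ) ∨ ω r₃ 0 + ((r₃ - (r₂ + 1) : ℕ) : ℤ) = ω r₂ 0 := by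
    clear he₁ he₂ he₃ he₄ hrun1 hrun2 hrun3 hrun4 hrun5 hR0 hR6; rcases he₅ with h | h <;> rw [h] at hG <;> omega
  have E1 : e₁ = -1 := by
    clear he₂ he₃ he₄ he₅ hrun1 hrun2 hrun3 hrun4 hrun5 hR0 hR6
    rcases he₁ with h | h
    · exfalso; rw [h] at hB; omega
    · exact h
  subst E1
  have E2 : e₂ = 1 := by
    clear he₃ he₄ he₅ hrun1 hrun2 hrun3 hrun4 hrun5 hR0 hR6
    rcases he₂ with h | h
    · exact h
    · exfalso; rw [h] at hC; omega
  subst E2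
  have E3 : e₃ = 1 := by
    clear he₄ he₅ hrun1 hrun2 hrun3 hrun4 hrun5 hR0 hR6
    rcases he₃ with h | h
    · exact h
    · exfalso; rw [h] at hD; omega
  subst E3
  have E4 : e₄ = -1 := by
    clear he₅ hrun1 hrun2 hrun3 hrun4 hrun5 hR0 hR6
    rcases he₄ with h | h
    · exfalso; rw [h] at hE; omega
    · exact h
  subst E4
  have E5 : e₅ = -1 := by
    clear  hrun1 hrun2 hrun3 hrun4 hrun5 hR0 hR6
    rcases he₅ with h | h
    · exfalso; rw [h] at hG; omega
    · exact h
  subst E5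
  have heq : ω = s3f k (p₁ / 2) ((p₃ - p₂ - 2) / 2) ((r₂ - r₁ - 2) / 2) :=
    eq_tab_walk_of_forall hs (ddduuu4_table_f (k := k) (p := p₁) (p₂ := p₂) (p₃ := p₃) (r₁ := r₁) (r₂ := r₂)
    (r₃ := r₃) (a := p₁ / 2) (i := (p₃ - p₂ - 2) / 2) (u
        := (r₂ - r₁ - 2) / 2) (by omega) (by omega) (by omega) hR0 hrun1 hrun2 hrun3
    hrun4 hrun5 hR6 (by omega) (by omega) (by omega) (by omega) (by omega) (by omega))
  refine ⟨heq, ?_⟩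
  rw [heq]
  exact s3f_mem_dddBlocks (by omega) (by omega) (by omega)

/-- **A block satisfying system B3 is the table walk `s3g`** with the parameters read off its step times
(signs of the five body runs are forced by the system; then `ddduuu4_table_g` and `eq_tab_walk_of_forall`); in
    particular it
lies in `dddBlocks k`.
[cite: MadrasSlade1993, §4.2, Definition 4.2.1 (p. 90)] [cite: EntingJensen2009, §7.4.2, Fig. 7.10] -/
theorem ddduuu4_eq_s3g {k m p₁ p₂ p₃ r₁ r₂ r₃ c1 c2 c3 c4 c5 : ℕ} {e₁ e₂ e₃ e₄ e₅ : ℤ} (hm : m = 6 * k + 4)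
    (hs : ω ∈ saws m) (hR0 : ∀ i, i ≤ p₁ → ω i 0 = i ∧ ω i 1 = 0) (he₁ : e₁ = 1 ∨ e₁ = -1) (he₂ : e₂ = 1 ∨ e₂ = -1)
    (he₃ : e₃ = 1 ∨ e₃ = -1) (he₄ : e₄ = 1 ∨ e₄ = -1) (he₅ : e₅ = 1 ∨ e₅ = -1)
    (hrun1 : ∀ i, p₁ + 1 ≤ i → i ≤ p₂ → ω i 0 = p₁ + e₁ * ((i - (p₁ + 1) : ℕ) : ℤ) ∧ ω i 1 = -1)
    (hrun2 : ∀ i, p₂ + 1 ≤ i → i ≤ p₃ → ω i 0 = ω p₂ 0 + e₂ * ((i - (p₂ + 1) : ℕ) : ℤ) ∧ ω i 1 = -2)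
    (hrun3 : ∀ i, p₃ + 1 ≤ i → i ≤ r₁ → ω i 0 = ω p₃ 0 + e₃ * ((i - (p₃ + 1) : ℕ) : ℤ) ∧ ω i 1 = -3)
    (hrun4 : ∀ i, r₁ + 1 ≤ i → i ≤ r₂ → ω i 0 = ω r₁ 0 + e₄ * ((i - (r₁ + 1) : ℕ) : ℤ) ∧ ω i 1 = -2)
    (hrun5 : ∀ i, r₂ + 1 ≤ i → i ≤ r₃ → ω i 0 = ω r₂ 0 + e₅ * ((i - (r₂ + 1) : ℕ) : ℤ) ∧ ω i 1 = -1)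
    (hR6 : ∀ j, r₃ + 1 ≤ j → j ≤ m → ω j 0 = ω r₃ 0 + ((j - (r₃ + 1) : ℕ) : ℤ) ∧ ω j 1 = 0)
    (_hq2 : p₁ + 2 ≤ p₂) (_hq3 : p₂ + 2 ≤ p₃) (_hr2 : p₃ + 2 ≤ r₁) (_hr4 : r₁ + 2 ≤ r₂) (_hr5 : r₂ + 2 ≤ r₃)
    (_hr3m : r₃ < m) (_hC1 : (c1 : ℤ) = ω p₂ 0) (_hC2 : (c2 : ℤ) = ω p₃ 0) (_hC3 : (c3 : ℤ) = ω r₁ 0)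
    (_hC4 : (c4 : ℤ) = ω r₂ 0) (_hC5 : (c5 : ℤ) = ω r₃ 0) (_hs_eq : r₃ + 2 * k + 1 = m + p₁)
    (_hN : ω m 0 + p₁ = ω r₃ 0 + 2 * k) (_hX1 : ω p₂ 0 ≤ ω m 0) (_hX2 : ω p₃ 0 ≤ ω m 0) (_hX3 : ω r₁ 0 ≤ ω m 0)
    (_hX4 : ω r₂ 0 ≤ ω m 0) (_hpodd : p₁ % 2 = 1) (_hbev : ω p₂ 0 % 2 = 0) (_hcodd : ω p₃ 0 % 2 = 1)
    (_hdodd : ω r₁ 0 % 2 = 1) (_heev : ω r₂ 0 % 2 = 0) (_hgodd : ω r₃ 0 % 2 = 1) (_hb1 : 0 < ω p₂ 0)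
    (_hc1 : 0 < ω p₃ 0) (_hd1 : 0 < ω r₁ 0) (_he1 : 0 < ω r₂ 0)
    (hF :
      p₁ + 1 = 2 * k ∧ c1 = 2 ∧ c2 = 2 + (p₃ - p₂ - 1) ∧ c3 = c2 + (r₁ - p₃ - 1) ∧ c4 = c3 + (r₂ - r₁ - 1) ∧ c5 = 2
      * k + 3 ∧ (r₃ - r₂ - 1) ≤ 3) :
    ω = s3g k ((p₃ - p₂ - 2) / 2) ((r₂ - r₁ - 2) / 2) ((r₃ - r₂ - 2) / 2) ∧ ω ∈ dddBlocks k := by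
  subst hm
  have hB := (hrun1 p₂ (by omega) le_rfl).1
  have hC := (hrun2 p₃ (by omega) le_rfl).1
  have hD := (hrun3 r₁ (by omega) le_rfl).1
  have hE := (hrun4 r₂ (by omega) le_rfl).1
  have hG := (hrun5 r₃ (by omega) le_rfl).1
  -- sign-free end-column relations of all five runs (so that each sign is pinned with the others available)
  have S1 : ω p₂ 0 = p₁ + ((p₂ - (p₁ + 1) : ℕ) : ℤ) ∨ ω p₂ 0 + ((p₂ - (p₁ + 1) : ℕ) : ℤ) = p₁ := by
    clear he₂ he₃ he₄ he₅ hrun1 hrun2 hrun3 hrun4 hrun5 hR0 hR6; rcases he₁ with h | h <;> rw [h] at hB <;> omega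
  have S2 : ω p₃ 0 = ω p₂ 0 + ((p₃ - (p₂ + 1) : ℕ) : ℤ) ∨ ω p₃ 0 + ((p₃ - (p₂ + 1) : ℕ) : ℤ) = ω p₂ 0 := by
    clear he₁ he₃ he₄ he₅ hrun1 hrun2 hrun3 hrun4 hrun5 hR0 hR6; rcases he₂ with h | h <;> rw [h] at hC <;> omega
  have S3 : ω r₁ 0 = ω p₃ 0 + ((r₁ - (p₃ + 1) : ℕ) : ℤ) ∨ ω r₁ 0 + ((r₁ - (p₃ + 1) : ℕ) : ℤ) = ω p₃ 0 := by
    clear he₁ he₂ he₄ he₅ hrun1 hrun2 hrun3 hrun4 hrun5 hR0 hR6; rcases he₃ with h | h <;> rw [h] at hD <;> omega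
  have S4 : ω r₂ 0 = ω r₁ 0 + ((r₂ - (r₁ + 1) : ℕ) : ℤ) ∨ ω r₂ 0 + ((r₂ - (r₁ + 1) : ℕ) : ℤ) = ω r₁ 0 := by
    clear he₁ he₂ he₃ he₅ hrun1 hrun2 hrun3 hrun4 hrun5 hR0 hR6; rcases he₄ with h | h <;> rw [h] at hE <;> omega
  have S5 : ω r₃ 0 = ω r₂ 0 + ((r₃ - (r₂ + 1) : ℕ) : ℤ) ∨ ω r₃ 0 + ((r₃ - (r₂ + 1) : ℕ) : ℤ) = ω r₂ 0 := by
    clear he₁ he₂ he₃ he₄ hrun1 hrun2 hrun3 hrun4 hrun5 hR0 hR6; rcases he₅ with h | h <;> rw [h] at hG <;> omega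
  have E1 : e₁ = -1 := by
    clear he₂ he₃ he₄ he₅ hrun1 hrun2 hrun3 hrun4 hrun5 hR0 hR6
    rcases he₁ with h | h
    · exfalso; rw [h] at hB; omega
    · exact h
  subst E1
  have E2 : e₂ = 1 := by
    clear he₃ he₄ he₅ hrun1 hrun2 hrun3 hrun4 hrun5 hR0 hR6
    rcases he₂ with h | h
    · exact h
    · exfalso; rw [h] at hC; omega
  subst E2
  have E3 : e₃ = 1 := by
    clear he₄ he₅ hrun1 hrun2 hrun3 hrun4 hrun5 hR0 hR6
    rcases he₃ with h | h
    · exact h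
    · exfalso; rw [h] at hD; omega
  subst E3
  have E4 : e₄ = 1 := by
    clear he₅ hrun1 hrun2 hrun3 hrun4 hrun5 hR0 hR6
    rcases he₄ with h | h
    · exact h
    · exfalso; rw [h] at hE; omega
  subst E4
  have E5 : e₅ = 1 := by
    clear  hrun1 hrun2 hrun3 hrun4 hrun5 hR0 hR6
    rcases he₅ with h | h
    · exact h
    · exfalso; rw [h] at hG; omega
  subst E5
  have heq : ω = s3g k ((p₃ - p₂ - 2) / 2) ((r₂ - r₁ - 2) / 2) ((r₃ - r₂ - 2) / 2) :=
    eq_tab_walk_of_forall hs (ddduuu4_table_g (k := k) (p := p₁) (p₂ := p₂) (p₃ := p₃) (r₁ := r₁) (r₂ := r₂)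
    (r₃ := r₃) (i := (p₃ - p₂ - 2) / 2) (u := (r₂ - r₁ - 2) / 2) (g
        := (r₃ - r₂ - 2) / 2) (by omega) (by omega) hR0 hrun1 hrun2 hrun3
    hrun4 hrun5 hR6 (by omega) (by omega) (by omega) (by omega) (by omega) (by omega))
  refine ⟨heq, ?_⟩
  rw [heq]
  exact s3g_mem_dddBlocks (by omega) (by omega)

/-! ### §3  Classification of the three-down stratum at slack four and the exact three-down law -/

/-- ★★ **Classification of the three-down stratum at slack four.**  For `k ≥ 2`, an irreducible positive wall bridge of
length `6k + 4` with `k` surface visits and exactly three down steps is one of the `(k−1)(2k²+3k−4)/2` table walks of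
`dddBlocks k` (families A2, A3, A4, A5, A6, B2,
    B3 of `…ThreeDownFamilies`; orders `D D D U U U`) or the bump-then-hairpin
block `g3b k` (order `D U D D U U`).  Proof: `three_down_slack_four` separates the orders; for `D D D U U U` the runs
(`ddduuu4_runs`), the seven linear systems (`ddduuu4_families`) and the identification `ddduuu4_eq_s3a … _s3g` (§2).
OURS — the hexagonal-lattice analogue of enumerating irreducible bridges by dives. [cite: MadrasSlade1993, §4.2,
Definition 4.2.1 (p. 90); §1.2, Definition 1.2.4 (p. 11)] [cite: EntingJensen2009, §7.4.2, Fig. 7.10] -/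
theorem three_down_mem_dddBlocks_or_eq_g3b {k m : ℕ} (hk : 2 ≤ k) (hm : m = 6 * k + 4) (hω : ω ∈ ipwb m)
    (hv : visits m ω = k) (hcD : #(stepsD m ω) = 3) : ω ∈ dddBlocks k ∨ ω = g3b k := by
  classical
  have hcU : #(stepsU m ω) = 3 := by rw [card_stepsU_eq_card_stepsD hω (by omega), hcD]
  obtain ⟨p₁, p₂, p₃, r₁, r₂, r₃, hD, hU, h12, h23, hr12, hr23, -, -, -, hp1, -, hR0, hP1x, hP1y, hhor, -⟩ :=
    profile_of_card_stepsD_eq_three hω hcD hcU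
  obtain ⟨hpw, hn1, hirr⟩ := mem_ipwb.1 hω
  obtain ⟨hw, hbr⟩ := mem_pwb.1 hpw
  obtain ⟨ha, -⟩ := mem_wbr.1 hw
  obtain ⟨hh, -, -⟩ := mem_archs.1 ha
  obtain ⟨hs, hhp⟩ := mem_hpw.1 hh
  obtain ⟨h0, -, hbw, hinj⟩ := mem_saws_iff.1 hs
  have hX0 : ω 0 0 = 0 := by rw [h0]; rfl
  have hb' : ∀ i, 1 ≤ i → i ≤ m → 0 < ω i 0 ∧ ω i 0 ≤ ω m 0 := fun i h1 h2 => by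
    have := hbr i h1 h2; rwa [hX0] at this
  -- `p₃ ≠ r₁`; an up step before the third down step singles out `g3b k`
  obtain ⟨-, -, hpy3, -⟩ := of_mem_stepsD_coord hbw (i := p₃) (by rw [hD]; simp)
  obtain ⟨-, -, hry1, -⟩ := of_mem_stepsU_coord hbw (i := r₁) (by rw [hU]; simp)
  have n31 : p₃ ≠ r₁ := by intro h; rw [h] at hpy3; omega
  rcases Nat.lt_or_gt_of_ne n31 with h3 | h3
  swap
  · exact Or.inr (eq_g3b_of_three_down_of_up_lt_down hk hm hω hv hcD (r := r₁) (p := p₃) (by rw [hU]; simp)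
      (by rw [hD]; simp) h3)
  left
  -- order `D D D U U U`: runs, systems, identification
  obtain ⟨e₁, e₂, e₃, e₄, e₅, he₁, he₂, he₃, he₄, he₅, hrun1, hrun2, hrun3, hrun4, hrun5, hR6, hs_eq, hN, hbev, hcodd,
    hdodd, heev, hb1, hc1, hd1, he1, hq2, hq3, hr2, hr3m⟩ :=
    ddduuu4_runs hm hω hv hD hU h12 h23 hr12 hr23 h3 hp1 hR0 hP1x hP1y hhor
  obtain ⟨c1, c2, c3, c4, c5, hC1, hC2, hC3, hC4, hC5, -, H⟩ :=
    ddduuu4_families hk hm hω hv hD hU h12 h23 hr12 hr23 h3 hp1 hR0 hP1x hP1y hhor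
  obtain ⟨-, -, -, hppar1⟩ := of_mem_stepsD_coord hbw (i := p₁) (by rw [hD]; simp)
  have hpodd : p₁ % 2 = 1 := by rw [hP1x, hP1y] at hppar1; omega
  have hXev : ω m 0 % 2 = 0 := by
    have := parity_apply hs (i := m) le_rfl; rw [(hR6 m (by omega) le_rfl).2] at this; omega
  have hgodd : ω r₃ 0 % 2 = 1 := by omega
  have hr4 : r₁ + 2 ≤ r₂ := by
    by_contra hcon
    have h0 : (r₂ - (r₁ + 1) : ℕ) = 0 := by omega
    have := (hrun4 r₂ (by omega) le_rfl).1
    rw [h0] at this; push_cast at this; simp only [mul_zero, add_zero] at this; omega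
  have hr5 : r₂ + 2 ≤ r₃ := by
    by_contra hcon
    have h0 : (r₃ - (r₂ + 1) : ℕ) = 0 := by omega
    have := (hrun5 r₃ (by omega) le_rfl).1
    rw [h0] at this; push_cast at this; simp only [mul_zero, add_zero] at this; omega
  have hX1 := (hb' p₂ (by omega) (by omega)).2
  have hX2 := (hb' p₃ (by omega) (by omega)).2
  have hX3 := (hb' r₁ (by omega) (by omega)).2
  have hX4 := (hb' r₂ (by omega) (by omega)).2
  clear hhor hbr hb' hirr hP1x hP1y hppar1 hpy3 hry1 n31
  rcases H with hF | hF | hF | hF | hF | hF | hF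
  · exact (ddduuu4_eq_s3a hm hs hR0 he₁ he₂ he₃ he₄ he₅ hrun1 hrun2 hrun3 hrun4 hrun5 hR6 hq2 hq3 hr2 hr4 hr5 hr3m
      hC1 hC2
      hC3 hC4 hC5 hs_eq hN hX1 hX2 hX3 hX4 hpodd hbev hcodd hdodd heev hgodd hb1 hc1 hd1 he1 hF).2
  · exact (ddduuu4_eq_s3b hm hs hR0 he₁ he₂ he₃ he₄ he₅ hrun1 hrun2 hrun3 hrun4 hrun5 hR6 hq2 hq3 hr2 hr4 hr5 hr3m
      hC1 hC2
      hC3 hC4 hC5 hs_eq hN hX1 hX2 hX3 hX4 hpodd hbev hcodd hdodd heev hgodd hb1 hc1 hd1 he1 hF).2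
  · exact (ddduuu4_eq_s3c hm hs hR0 he₁ he₂ he₃ he₄ he₅ hrun1 hrun2 hrun3 hrun4 hrun5 hR6 hq2 hq3 hr2 hr4 hr5 hr3m
      hC1 hC2
      hC3 hC4 hC5 hs_eq hN hX1 hX2 hX3 hX4 hpodd hbev hcodd hdodd heev hgodd hb1 hc1 hd1 he1 hF).2
  · exact (ddduuu4_eq_s3d hm hs hR0 he₁ he₂ he₃ he₄ he₅ hrun1 hrun2 hrun3 hrun4 hrun5 hR6 hq2 hq3 hr2 hr4 hr5 hr3m
      hC1 hC2
      hC3 hC4 hC5 hs_eq hN hX1 hX2 hX3 hX4 hpodd hbev hcodd hdodd heev hgodd hb1 hc1 hd1 he1 hF).2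
  · exact (ddduuu4_eq_s3e hm hs hR0 he₁ he₂ he₃ he₄ he₅ hrun1 hrun2 hrun3 hrun4 hrun5 hR6 hq2 hq3 hr2 hr4 hr5 hr3m
      hC1 hC2
      hC3 hC4 hC5 hs_eq hN hX1 hX2 hX3 hX4 hpodd hbev hcodd hdodd heev hgodd hb1 hc1 hd1 he1 hF).2
  · exact (ddduuu4_eq_s3f hm hs hR0 he₁ he₂ he₃ he₄ he₅ hrun1 hrun2 hrun3 hrun4 hrun5 hR6 hq2 hq3 hr2 hr4 hr5 hr3m
      hC1 hC2
      hC3 hC4 hC5 hs_eq hN hX1 hX2 hX3 hX4 hpodd hbev hcodd hdodd heev hgodd hb1 hc1 hd1 he1 hF).2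
  · exact (ddduuu4_eq_s3g hm hs hR0 he₁ he₂ he₃ he₄ he₅ hrun1 hrun2 hrun3 hrun4 hrun5 hR6 hq2 hq3 hr2 hr4 hr5 hr3m
      hC1 hC2
      hC3 hC4 hC5 hs_eq hN hX1 hX2 hX3 hX4 hpodd hbev hcodd hdodd heev hgodd hb1 hc1 hd1 he1 hF).2

/-- ★★★ **The exact three-down law at slack four.**  For `k ≥ 2`, exactly `(k−1)(2k²+3k−4)/2 + 1` irreducible positive
wall bridges of length `6k + 4` with `k` surface visits have exactly three down steps (`= 6, 24, 61, 123, 216, 346, …`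
for `k = 2, 3, …`; the lane's enumeration agrees for `k ≤ 15`).  Upper bound: the classification above; lower bound:
`le_two_mul_card_filter_visits_three_down_succ` of `…ThreeDownFloor`.  Third rung, after the one-down and two-down laws,
of the surface renewal structure behind the critical fugacity `1 + √2`. OURS. [cite: MadrasSlade1993, §4.2, Definition
4.2.1 (p. 90), (4.2.2)] [cite: BeatonBousquetMelouDeGierDuminilCopinGuttmann2014, §3.1]
[cite: EntingJensen2009, §7.4.2, Fig. 7.10] -/
theorem two_mul_card_filter_visits_three_down {k m : ℕ} (hk : 2 ≤ k) (hm : m = 6 * k + 4) :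
    2 * #((ipwb m).filter fun ω => visits m ω = k ∧ #(stepsD m ω) = 3) = (k - 1) * (2 * k * k + 3 * k - 4) + 2 := by
  classical
  refine le_antisymm ?_ (le_two_mul_card_filter_visits_three_down_succ hk hm)
  have hsub : ((ipwb m).filter fun ω => visits m ω = k ∧ #(stepsD m ω) = 3) ⊆ insert (g3b k) (dddBlocks k) := by
    intro w hw
    rw [Finset.mem_filter] at hw
    rcases three_down_mem_dddBlocks_or_eq_g3b hk hm hw.1 hw.2.1 hw.2.2 with h | h
    · exact Finset.mem_insert_of_mem h
    · rw [h]; exact Finset.mem_insert_self _ _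
  have h1 := Finset.card_le_card hsub
  have h2 := Finset.card_insert_le (g3b k) (dddBlocks k)
  have h3 := two_mul_card_dddBlocks hk
  omega

end Literature.Probability.RandomPlanarGeometry.SAW.HexBW.Wall
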